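import Literature.NumberTheory.LFunctions.LargeValuesS2GeneralK
import Literature.NumberTheory.LFunctions.LargeValuesAssembly
import Literature.NumberTheory.LFunctions.SeparatedPointSums
import Literature.NumberTheory.LFunctions.LargeValuesLongPolynomials
import Literature.NumberTheory.LFunctions.Jutila1977LargeValuesReduction
import Literature.NumberTheory.LFunctions.LargeValuesJutilaSubdivision
import Mathlib.Analysis.MeanInequalitiesPow
import Mathlib.Algebra.Order.Chebyshev
import HarnessLib

/-!
# Jutila 1977, Theorem (1.2) at `q = 1`, `σ = 0`: the kernel (F3 discharge, cell rh-crit C4)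

[topic NumberTheory/LFunctions]

M. Jutila, *Zero-density estimates for L-functions*, Acta Arith. 32 (1977) 55–62, §3, proof of
(1.2) in the case `q = 1` (one Dirichlet polynomial `f(it) = ∑_{N<n≤2N} a_n n^{−it}`, `1`-separated
real points `t_r` with pairwise distances `≤ T`, `|f(it_r)| ≥ V`):

  `R ≪_{ε,k} (GNV^{−2} + T(G⁴N²V^{−8})^k + (TG²V^{−4})^k) T^ε`,  `G = ∑ |a_n|²`.

Architecture (Jutila §3 with the analytic inputs taken from the Guth–Maynard corpus of the tree,
ruling A2/A2' of the cell): the Halász–Montgomery inequality (3.1) in SUM form for the smoothly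
weighted pieces `w(n/N')` of the block (`GuthMaynardReduction.norm_sum_Icc_le_three_pieces`), whose
Gram entries are `∑_n w(n/N')² n^{i(t−t')} = N'^{1+i(t−t')}(A(t−t') + B_{N'}(t−t'))` by Poisson
summation (`GuthMaynardFourier.sum_weight_sq_cpow_eq`, Guth–Maynard Lemma 4.5); the diagonal and the
`A`-part are `≪ G R N'` (`norm_coefA_le_div`, decay `|τ|^{−2}` summed over `1`-separated points);
the `B`-part is the PAIR-CORRELATION BOUND (§KERNEL-B, Guth–Maynard Lemma 6.2 + Heath-Brown in
place of Jutila's Lemmas 1–3), giving Jutila's display after (3.2); solving for `R`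
(`Jutila1977.R_le_of_holder_bound`) gives (1.2).

* §SOLVE-R `Jutila1977.R_le_of_holder_bound` — the last arrow of §3 (real bookkeeping);
* §KERNEL-A `Jutila1977.core_of_pairBound` — (1.2) at `q = 1`, `σ = 0` (the cell's `CORE₀` text,
  i.e. the hypothesis of the tree's `Jutila1977.eq_1_2_q1_of_core`) from the pair-correlation bound
  `hB` (the cell's KERNEL-B statement for `B_N`, taken as a HYPOTHESIS here; it is proved separately,
  seat rh-crit-gm-t2, from Guth–Maynard Lemma 6.2 and Heath-Brown's theorem);
* §HOLDS (conditional form) `Jutila1977.theorem_1_4_of_pairBound`,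
  `Jutila1977.largeValues_of_pairBound` — composing with the tree's outer chain
  (`eq_1_2_q1_of_core`, `theorem_1_4_of_theorem_1_2`, `Jutila1977_largeValues_of_theorem_1_4`):
  the pair-correlation bound alone implies Jutila's (1.4) as printed and `Jutila1977_largeValues`.

Everything in this file is proved; no named fact is introduced (the pair-correlation bound enters
only as an explicit hypothesis of the three `_of_pairBound` theorems).

## References

* M. Jutila, *Zero-density estimates for L-functions*, Acta Arith. 32 (1977) 55–62: Theorem (1.2)
  p. 56, §3 pp. 59–60 ((3.1), (3.2) and the display following it).
* L. Guth, J. Maynard, *New large value estimates for Dirichlet polynomials*, Ann. of Math. (2) 203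
  (2026); arXiv:2405.20552v2: Lemmas 4.3, 4.5, 6.2 (the reflection/Poisson inputs).
* H. L. Montgomery, *Topics in multiplicative number theory*, LNM 227 (1971), Ch. 8 (Halász's method).
-/

noncomputable section

open Real NNReal Complex Finset
open scoped ComplexConjugate ContDiff

namespace Literature.NumberTheory.LFunctions

namespace Jutila1977

/-! ## §SOLVE-R: solving the Hölder-type inequality of §3 for `R` (block by rh-crit-gm-t4) -/

/-- `(x + y)^p ≤ x^p + y^p` for `x, y ≥ 0`, `0 ≤ p ≤ 1` (real version of
`NNReal.rpow_add_le_add_rpow`); private plumbing. [folklore] -/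
private lemma add_rpow_le_rpow_add {x y p : ℝ} (hx : 0 ≤ x) (hy : 0 ≤ y) (hp : 0 ≤ p)
    (hp1 : p ≤ 1) : (x + y) ^ p ≤ x ^ p + y ^ p := by
  lift x to ℝ≥0 using hx
  lift y to ℝ≥0 using hy
  exact_mod_cast NNReal.rpow_add_le_add_rpow x y hp hp1

/-- From `R^q ≤ Y` (`R, Y ≥ 0`, `q > 0`) to `R ≤ Y^{1/q}`; private plumbing. [folklore] -/
private lemma le_rpow_inv_of_rpow_le {R Y q : ℝ} (hR : 0 ≤ R) (hq : 0 < q) (h : R ^ q ≤ Y) :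
    R ≤ Y ^ (1 / q) := by
  have hY : 0 ≤ Y := le_trans (Real.rpow_nonneg hR q) h
  calc R = (R ^ q) ^ (1 / q) := by
        rw [← Real.rpow_mul hR, mul_one_div_cancel hq.ne', Real.rpow_one]
    _ ≤ Y ^ (1 / q) := Real.rpow_le_rpow (Real.rpow_nonneg hR q) h (by positivity)

set_option maxHeartbeats 800000 in
/-- **Jutila's §3, last step of the proof of (1.2) (case `q = 1`): solving for `R`.** If
`R, G ≥ 0`, `V, N, T > 0`, `L ≥ 1`, `C ≥ 0`, `k ≥ 1` and
`R²V² ≤ C (GRN + G N^{1/2} L R^{2−1/k} (R((T/N)^k + (RT)^{1/2}))^{1/(2k)})`, then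
`R ≤ (3·max(1,C)·L)^{4k} (GNV^{−2} + T(G⁴N²V^{−8})^k + (TG²V^{−4})^k)`: one of the three terms
`GRN`, `G L T^{1/2} R^{2−1/(2k)}`, `G N^{1/2} L T^{1/(4k)} R^{2−1/(4k)}` (after
`(u+v)^{1/(2k)} ≤ u^{1/(2k)} + v^{1/(2k)}`) is at least a third of `R²V²`, and each case is solved for
`R`. "The term `GR²` can be omitted here, so we get an inequality which implies (1.2)."
[cite: Jutila1977, §3, proof of (1.2), p. 60 (display after (3.2))] -/
theorem R_le_of_holder_bound {R V G N T L C : ℝ} {k : ℕ} (hk : 1 ≤ k) (hR : 0 ≤ R)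
    (hV : 0 < V) (hG : 0 ≤ G) (hN : 0 < N) (hT : 0 < T) (hL : 1 ≤ L) (hC : 0 ≤ C)
    (h : R ^ 2 * V ^ 2 ≤ C * (G * R * N + G * N ^ (1 / 2 : ℝ) * L * R ^ (2 - 1 / k : ℝ) *
      (R * ((T / N) ^ k + (R * T) ^ (1 / 2 : ℝ))) ^ (1 / (2 * k) : ℝ))) :
    R ≤ (3 * max 1 C * L) ^ (4 * k) *
      (G * N * V ^ (-2 : ℝ) + T * (G ^ 4 * N ^ 2 * V ^ (-8 : ℝ)) ^ k +
        (T * (G ^ 2 * V ^ (-4 : ℝ))) ^ k) := by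
  have hk0 : (0 : ℝ) < k := by exact_mod_cast (by omega : 0 < k)
  have hL0 : 0 < L := by linarith
  set M : ℝ := 3 * max 1 C * L with hM
  have hM1 : 1 ≤ M := by
    have h1 : (1 : ℝ) ≤ max 1 C := le_max_left _ _
    rw [hM]; nlinarith
  have hM0 : 0 < M := by linarith
  have hMC : 3 * C ≤ M := by
    rw [hM]; nlinarith [le_max_right 1 C, le_max_left 1 C]
  have hMCL : 3 * C * L ≤ M := by
    rw [hM]; nlinarith [le_max_right 1 C]
  -- the three printed terms are nonnegative
  have ha0 : 0 ≤ G * N * V ^ (-2 : ℝ) := by positivity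
  have hb0 : 0 ≤ T * (G ^ 4 * N ^ 2 * V ^ (-8 : ℝ)) ^ k := by positivity
  have hc0 : 0 ≤ (T * (G ^ 2 * V ^ (-4 : ℝ))) ^ k := by positivity
  have hM4k : 1 ≤ M ^ (4 * k) := one_le_pow₀ hM1
  rcases hR.eq_or_lt with hR0 | hRpos
  · rw [← hR0]; positivity
  -- Step 1: split `(R(u+v))^{1/(2k)} ≤ R^{1/(2k)} (u^{1/(2k)} + v^{1/(2k)})`
  set p : ℝ := 1 / (2 * k) with hp
  have hp0 : 0 < p := by positivity
  have hp1 : p ≤ 1 := by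
    rw [hp, div_le_one (by positivity)]
    have : (1 : ℝ) ≤ k := by exact_mod_cast hk
    linarith
  have hu0 : 0 ≤ (T / N) ^ k := by positivity
  have hv0 : 0 ≤ (R * T) ^ (1 / 2 : ℝ) := by positivity
  have hsplit : (R * ((T / N) ^ k + (R * T) ^ (1 / 2 : ℝ))) ^ p ≤
      R ^ p * ((T / N) ^ (1 / 2 : ℝ)) + R ^ p * (R * T) ^ (1 / (4 * k) : ℝ) := by
    rw [Real.mul_rpow hR (by positivity)]
    have h1 := add_rpow_le_rpow_add hu0 hv0 hp0.le hp1
    have hu : ((T / N) ^ k) ^ p = (T / N) ^ (1 / 2 : ℝ) := by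
      rw [← Real.rpow_natCast, ← Real.rpow_mul (by positivity), hp]
      congr 1; field_simp
    have hv : ((R * T) ^ (1 / 2 : ℝ)) ^ p = (R * T) ^ (1 / (4 * k) : ℝ) := by
      rw [← Real.rpow_mul (by positivity), hp]
      congr 1; field_simp; ring
    rw [hu, hv] at h1
    have hRp : 0 ≤ R ^ p := Real.rpow_nonneg hR p
    nlinarith [h1, hRp]
  -- the three terms
  set t₁ : ℝ := G * R * N with ht₁
  set t₂ : ℝ := G * L * T ^ (1 / 2 : ℝ) * R ^ (2 - p) with ht₂
  set t₃ : ℝ := G * N ^ (1 / 2 : ℝ) * L * T ^ (1 / (4 * k) : ℝ) * R ^ (2 - p / 2) with ht₃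
  -- exponent identities
  have hRpow : ∀ x y : ℝ, R ^ (x + y) = R ^ x * R ^ y := fun x y ↦ Real.rpow_add hRpos x y
  have hk2 : (2 - 1 / k : ℝ) = (2 - p) - p := by rw [hp]; field_simp; ring
  have e2 : N ^ (1 / 2 : ℝ) * R ^ (2 - 1 / k : ℝ) * (R ^ p * (T / N) ^ (1 / 2 : ℝ)) =
      T ^ (1 / 2 : ℝ) * R ^ (2 - p) := by
    rw [hk2, show (2 - p - p : ℝ) = (2 - p) + (-p) by ring, hRpow, Real.div_rpow hT.le hN.le]
    have hNh : 0 < N ^ (1 / 2 : ℝ) := Real.rpow_pos_of_pos hN _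
    have hRp : R ^ (-p) * R ^ p = 1 := by
      rw [← Real.rpow_add hRpos, neg_add_cancel, Real.rpow_zero]
    have e : N ^ (1 / 2 : ℝ) * (R ^ (2 - p) * R ^ (-p)) * (R ^ p * (T ^ (1 / 2 : ℝ) / N ^ (1 / 2 : ℝ))) =
        T ^ (1 / 2 : ℝ) * R ^ (2 - p) * (R ^ (-p) * R ^ p) * (N ^ (1 / 2 : ℝ) / N ^ (1 / 2 : ℝ)) := by
      ring
    rw [e, hRp, div_self hNh.ne']; ring
  have e3 : R ^ (2 - 1 / k : ℝ) * (R ^ p * (R * T) ^ (1 / (4 * k) : ℝ)) =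
      T ^ (1 / (4 * k) : ℝ) * R ^ (2 - p / 2) := by
    rw [Real.mul_rpow hR hT.le, hk2]
    have hq : (1 / (4 * k) : ℝ) = p / 2 := by rw [hp]; field_simp; ring
    rw [hq]
    calc R ^ (2 - p - p) * (R ^ p * (R ^ (p / 2) * T ^ (p / 2)))
        = (R ^ (2 - p - p) * R ^ p * R ^ (p / 2)) * T ^ (p / 2) := by ring
      _ = R ^ (2 - p / 2) * T ^ (p / 2) := by
          rw [← hRpow, ← hRpow]; congr 1; ring_nf
      _ = _ := by ring
  have hmain : R ^ 2 * V ^ 2 ≤ C * t₁ + C * t₂ + C * t₃ := by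
    have hpre : 0 ≤ C * (G * N ^ (1 / 2 : ℝ) * L * R ^ (2 - 1 / k : ℝ)) := by positivity
    have h2 := mul_le_mul_of_nonneg_left hsplit hpre
    have hexp : C * (G * N ^ (1 / 2 : ℝ) * L * R ^ (2 - 1 / k : ℝ)) *
        (R ^ p * (T / N) ^ (1 / 2 : ℝ) + R ^ p * (R * T) ^ (1 / (4 * k) : ℝ)) = C * t₂ + C * t₃ := by
      have step : C * (G * N ^ (1 / 2 : ℝ) * L * R ^ (2 - 1 / k : ℝ)) *
          (R ^ p * (T / N) ^ (1 / 2 : ℝ) + R ^ p * (R * T) ^ (1 / (4 * k) : ℝ)) =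
          C * G * L * (N ^ (1 / 2 : ℝ) * R ^ (2 - 1 / k : ℝ) * (R ^ p * (T / N) ^ (1 / 2 : ℝ))) +
          C * G * N ^ (1 / 2 : ℝ) * L * (R ^ (2 - 1 / k : ℝ) * (R ^ p * (R * T) ^ (1 / (4 * k) : ℝ))) := by
        ring
      rw [step, e2, e3, ht₂, ht₃]; ring
    rw [hexp] at h2
    have : C * (G * R * N + G * N ^ (1 / 2 : ℝ) * L * R ^ (2 - 1 / k : ℝ) *
        (R * ((T / N) ^ k + (R * T) ^ (1 / 2 : ℝ))) ^ (1 / (2 * k) : ℝ)) =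
        C * t₁ + C * (G * N ^ (1 / 2 : ℝ) * L * R ^ (2 - 1 / k : ℝ)) *
          (R * ((T / N) ^ k + (R * T) ^ (1 / 2 : ℝ))) ^ p := by rw [ht₁, hp]; ring
    linarith [h, h2, this]
  have hV2 : 0 < V ^ 2 := by positivity
  have hVneg2 : V ^ (-2 : ℝ) = (V ^ 2)⁻¹ := by
    rw [Real.rpow_neg hV.le, show (2 : ℝ) = (2 : ℕ) by norm_num, Real.rpow_natCast]
  -- Step 2: three cases
  rcases le_or_gt (R ^ 2 * V ^ 2) (3 * C * t₁) with h1 | h1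
  · -- Case 1: `R V² ≤ 3 C G N`
    have hRV : R * V ^ 2 ≤ 3 * C * (G * N) := by
      have : R * (R * V ^ 2) ≤ R * (3 * C * (G * N)) := by rw [ht₁] at h1; nlinarith [h1]
      exact le_of_mul_le_mul_left this hRpos
    have hR1 : R ≤ 3 * C * (G * N * V ^ (-2 : ℝ)) := by
      rw [hVneg2, ← div_eq_mul_inv, mul_div_assoc', le_div_iff₀ hV2]; exact hRV
    calc R ≤ 3 * C * (G * N * V ^ (-2 : ℝ)) := hR1
      _ ≤ M ^ (4 * k) * (G * N * V ^ (-2 : ℝ)) := by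
          apply mul_le_mul_of_nonneg_right _ ha0
          calc 3 * C ≤ M := hMC
            _ = M ^ 1 := (pow_one M).symm
            _ ≤ M ^ (4 * k) := pow_le_pow_right₀ hM1 (by omega)
      _ ≤ _ := by
          have : 0 ≤ M ^ (4 * k) * (T * (G ^ 4 * N ^ 2 * V ^ (-8 : ℝ)) ^ k +
              (T * (G ^ 2 * V ^ (-4 : ℝ))) ^ k) := by positivity
          nlinarith [this]
  rcases le_or_gt (R ^ 2 * V ^ 2) (3 * C * t₂) with h2 | h2
  · -- Case 2: `R^{p} ≤ 3 C G L T^{1/2} V^{-2}`, `p = 1/(2k)`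
    have hRp : R ^ p * V ^ 2 ≤ 3 * C * (G * L * T ^ (1 / 2 : ℝ)) := by
      have hR2p : 0 < R ^ (2 - p) := Real.rpow_pos_of_pos hRpos _
      have e : R ^ 2 * V ^ 2 = R ^ (2 - p) * (R ^ p * V ^ 2) := by
        rw [show R ^ 2 = R ^ (2 : ℝ) by norm_num, show (2 : ℝ) = (2 - p) + p by ring, hRpow]
        ring_nf
      rw [e, ht₂, show 3 * C * (G * L * T ^ (1 / 2 : ℝ) * R ^ (2 - p)) =
        R ^ (2 - p) * (3 * C * (G * L * T ^ (1 / 2 : ℝ))) by ring] at h2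
      exact le_of_mul_le_mul_left h2 hR2p
    have hRp' : R ^ p ≤ 3 * C * (G * L * T ^ (1 / 2 : ℝ)) * V ^ (-2 : ℝ) := by
      rw [hVneg2, ← div_eq_mul_inv, le_div_iff₀ hV2]; exact hRp
    have hY0 : 0 ≤ 3 * C * (G * L * T ^ (1 / 2 : ℝ)) * V ^ (-2 : ℝ) := by positivity
    have hR2 : R ≤ (3 * C * (G * L * T ^ (1 / 2 : ℝ)) * V ^ (-2 : ℝ)) ^ (1 / p) :=
      le_rpow_inv_of_rpow_le hR hp0 hRp'
    have hinv : (1 / p : ℝ) = ((2 * k : ℕ) : ℝ) := by rw [hp]; push_cast; field_simp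
    rw [hinv, Real.rpow_natCast] at hR2
    -- `(3 C G L T^{1/2} V^{-2})^{2k} = (3 C L)^{2k} (T G² V^{-4})^k`
    have e : (3 * C * (G * L * T ^ (1 / 2 : ℝ)) * V ^ (-2 : ℝ)) ^ (2 * k) =
        (3 * C * L) ^ (2 * k) * (T * (G ^ 2 * V ^ (-4 : ℝ))) ^ k := by
      have hT2 : (T ^ (1 / 2 : ℝ)) ^ (2 * k) = T ^ k := by
        rw [← Real.rpow_natCast, ← Real.rpow_mul hT.le]
        push_cast
        rw [show (1 / 2 : ℝ) * (2 * k) = (k : ℕ) by ring, Real.rpow_natCast]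
      have hV4 : (V ^ (-2 : ℝ)) ^ (2 * k) = (V ^ (-4 : ℝ)) ^ k := by
        rw [← Real.rpow_natCast, ← Real.rpow_natCast (V ^ (-4 : ℝ)), ← Real.rpow_mul hV.le,
          ← Real.rpow_mul hV.le]
        push_cast; ring_nf
      have hG2 : G ^ (2 * k) = (G ^ 2) ^ k := pow_mul G 2 k
      calc (3 * C * (G * L * T ^ (1 / 2 : ℝ)) * V ^ (-2 : ℝ)) ^ (2 * k)
          = (3 * C * L) ^ (2 * k) * G ^ (2 * k) * (T ^ (1 / 2 : ℝ)) ^ (2 * k) *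
              (V ^ (-2 : ℝ)) ^ (2 * k) := by
            rw [← mul_pow, ← mul_pow, ← mul_pow]; ring
        _ = (3 * C * L) ^ (2 * k) * (T ^ k * ((G ^ 2) ^ k * (V ^ (-4 : ℝ)) ^ k)) := by
            rw [hT2, hV4, hG2]; ring
        _ = _ := by rw [← mul_pow, ← mul_pow]
    rw [e] at hR2
    have hcoef : (3 * C * L) ^ (2 * k) ≤ M ^ (4 * k) := by
      calc (3 * C * L) ^ (2 * k) ≤ M ^ (2 * k) := pow_le_pow_left₀ (by positivity) hMCL _
        _ ≤ M ^ (4 * k) := pow_le_pow_right₀ hM1 (by omega)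
    calc R ≤ (3 * C * L) ^ (2 * k) * (T * (G ^ 2 * V ^ (-4 : ℝ))) ^ k := hR2
      _ ≤ M ^ (4 * k) * (T * (G ^ 2 * V ^ (-4 : ℝ))) ^ k := mul_le_mul_of_nonneg_right hcoef hc0
      _ ≤ _ := by
          have : 0 ≤ M ^ (4 * k) * (G * N * V ^ (-2 : ℝ) + T * (G ^ 4 * N ^ 2 * V ^ (-8 : ℝ)) ^ k) := by
            positivity
          nlinarith [this]
  -- Case 3: `R^{p/2} ≤ 3 C G N^{1/2} L T^{1/(4k)} V^{-2}`
  have h3 : R ^ 2 * V ^ 2 ≤ 3 * C * t₃ := by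
    by_contra hcon
    push Not at hcon
    have hC0 : 0 ≤ C := hC
    nlinarith [hmain, h1, h2, hcon]
  have hRp : R ^ (p / 2) * V ^ 2 ≤ 3 * C * (G * N ^ (1 / 2 : ℝ) * L * T ^ (1 / (4 * k) : ℝ)) := by
    have hR2p : 0 < R ^ (2 - p / 2) := Real.rpow_pos_of_pos hRpos _
    have e : R ^ 2 * V ^ 2 = R ^ (2 - p / 2) * (R ^ (p / 2) * V ^ 2) := by
      rw [show R ^ 2 = R ^ (2 : ℝ) by norm_num, show (2 : ℝ) = (2 - p / 2) + p / 2 by ring, hRpow]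
      ring_nf
    rw [e, ht₃, show 3 * C * (G * N ^ (1 / 2 : ℝ) * L * T ^ (1 / (4 * k) : ℝ) * R ^ (2 - p / 2)) =
      R ^ (2 - p / 2) * (3 * C * (G * N ^ (1 / 2 : ℝ) * L * T ^ (1 / (4 * k) : ℝ))) by ring] at h3
    exact le_of_mul_le_mul_left h3 hR2p
  have hRp' : R ^ (p / 2) ≤ 3 * C * (G * N ^ (1 / 2 : ℝ) * L * T ^ (1 / (4 * k) : ℝ)) * V ^ (-2 : ℝ) := by
    rw [hVneg2, ← div_eq_mul_inv, le_div_iff₀ hV2]; exact hRp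
  have hR3 : R ≤ (3 * C * (G * N ^ (1 / 2 : ℝ) * L * T ^ (1 / (4 * k) : ℝ)) * V ^ (-2 : ℝ)) ^ (1 / (p / 2)) :=
    le_rpow_inv_of_rpow_le hR (by positivity) hRp'
  have hinv : (1 / (p / 2) : ℝ) = ((4 * k : ℕ) : ℝ) := by rw [hp]; push_cast; field_simp; ring
  rw [hinv, Real.rpow_natCast] at hR3
  have e : (3 * C * (G * N ^ (1 / 2 : ℝ) * L * T ^ (1 / (4 * k) : ℝ)) * V ^ (-2 : ℝ)) ^ (4 * k) =
      (3 * C * L) ^ (4 * k) * (T * (G ^ 4 * N ^ 2 * V ^ (-8 : ℝ)) ^ k) := by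
    have hT4 : (T ^ (1 / (4 * k) : ℝ)) ^ (4 * k) = T := by
      rw [← Real.rpow_natCast, ← Real.rpow_mul hT.le]
      push_cast
      rw [show (1 / (4 * k) : ℝ) * (4 * k) = 1 by field_simp, Real.rpow_one]
    have hN2 : (N ^ (1 / 2 : ℝ)) ^ (4 * k) = (N ^ 2) ^ k := by
      rw [← Real.rpow_natCast, ← Real.rpow_mul hN.le, show N ^ 2 = N ^ (2 : ℝ) by norm_num,
        ← Real.rpow_natCast, ← Real.rpow_mul hN.le]
      push_cast; ring_nf
    have hV8 : (V ^ (-2 : ℝ)) ^ (4 * k) = (V ^ (-8 : ℝ)) ^ k := by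
      rw [← Real.rpow_natCast, ← Real.rpow_natCast (V ^ (-8 : ℝ)), ← Real.rpow_mul hV.le,
        ← Real.rpow_mul hV.le]
      push_cast; ring_nf
    have hG4 : G ^ (4 * k) = (G ^ 4) ^ k := pow_mul G 4 k
    calc (3 * C * (G * N ^ (1 / 2 : ℝ) * L * T ^ (1 / (4 * k) : ℝ)) * V ^ (-2 : ℝ)) ^ (4 * k)
        = (3 * C * L) ^ (4 * k) * G ^ (4 * k) * (N ^ (1 / 2 : ℝ)) ^ (4 * k) *
            (T ^ (1 / (4 * k) : ℝ)) ^ (4 * k) * (V ^ (-2 : ℝ)) ^ (4 * k) := by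
          rw [← mul_pow, ← mul_pow, ← mul_pow, ← mul_pow]; ring
      _ = (3 * C * L) ^ (4 * k) * (T * ((G ^ 4) ^ k * (N ^ 2) ^ k * (V ^ (-8 : ℝ)) ^ k)) := by
          rw [hT4, hN2, hV8, hG4]; ring
      _ = _ := by rw [← mul_pow, ← mul_pow]
  rw [e] at hR3
  have hcoef : (3 * C * L) ^ (4 * k) ≤ M ^ (4 * k) := pow_le_pow_left₀ (by positivity) hMCL _
  calc R ≤ (3 * C * L) ^ (4 * k) * (T * (G ^ 4 * N ^ 2 * V ^ (-8 : ℝ)) ^ k) := hR3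
    _ ≤ M ^ (4 * k) * (T * (G ^ 4 * N ^ 2 * V ^ (-8 : ℝ)) ^ k) := mul_le_mul_of_nonneg_right hcoef hb0
    _ ≤ _ := by
        have : 0 ≤ M ^ (4 * k) * (G * N * V ^ (-2 : ℝ) + (T * (G ^ 2 * V ^ (-4 : ℝ))) ^ k) := by
          positivity
        nlinarith [this]

/-! ## §KERNEL-A, part 1: the Halász–Montgomery inequality in sum form, for finite sums
(block by rh-crit-gm-t4) -/

namespace KernelA

/-- **Halász–Montgomery inequality, sum form, for finite Dirichlet-type sums** (Jutila (3.1),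
Montgomery's form of Halász's lemma): if `|∑_{n∈I} u_n g_r(n)| ≥ V ≥ 0` for every `r ∈ S`, then
`(#S · V)² ≤ (∑_{n∈I} |u_n|²) · ∑_{r,q∈S} |∑_{n∈I} g_r(n) \overline{g_q(n)}|`.
[cite: Jutila1977, (3.1), p. 60] -/
theorem halasz_finset {ι κ : Type*} (S : Finset ι) (I : Finset κ) (u : κ → ℂ) (g : ι → κ → ℂ)
    {V : ℝ} (hV : 0 ≤ V) (hlarge : ∀ r ∈ S, V ≤ ‖∑ n ∈ I, u n * g r n‖) :
    ((S.card : ℝ) * V) ^ 2 ≤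
      (∑ n ∈ I, ‖u n‖ ^ 2) * ∑ r ∈ S, ∑ q ∈ S, ‖∑ n ∈ I, g r n * conj (g q n)‖ := by
  classical
  set F : ι → ℂ := fun r ↦ ∑ n ∈ I, u n * g r n with hF
  choose c hc1 hc2 using fun r ↦ exists_norm_le_one_mul_eq_norm (F r)
  set H : κ → ℂ := fun n ↦ ∑ r ∈ S, c r * g r n with hH
  set Ssum : ℝ := ∑ r ∈ S, ‖F r‖ with hSsum
  have hSV : (S.card : ℝ) * V ≤ Ssum := by
    calc (S.card : ℝ) * V = ∑ _r ∈ S, V := by simp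
      _ ≤ Ssum := Finset.sum_le_sum fun r hr ↦ hlarge r hr
  have hS0 : 0 ≤ Ssum := Finset.sum_nonneg fun r _ ↦ norm_nonneg _
  -- `Ssum = ∑_n u_n H_n`
  have hSeq : (Ssum : ℂ) = ∑ n ∈ I, u n * H n := by
    rw [hSsum, Complex.ofReal_sum]
    have : ∀ r ∈ S, ((‖F r‖ : ℝ) : ℂ) = ∑ n ∈ I, c r * (u n * g r n) := by
      intro r _
      rw [← hc2 r, hF]
      simp only
      rw [Finset.mul_sum]
    rw [Finset.sum_congr rfl this, Finset.sum_comm]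
    refine Finset.sum_congr rfl fun n _ ↦ ?_
    rw [hH]
    simp only
    rw [Finset.mul_sum]
    refine Finset.sum_congr rfl fun r _ ↦ ?_
    ring
  -- Cauchy–Schwarz
  have hCS : Ssum ^ 2 ≤ (∑ n ∈ I, ‖u n‖ ^ 2) * ∑ n ∈ I, ‖H n‖ ^ 2 := by
    have h1 : Ssum ≤ ∑ n ∈ I, ‖u n‖ * ‖H n‖ := by
      have : Ssum = ‖(Ssum : ℂ)‖ := by
        rw [Complex.norm_real, Real.norm_of_nonneg hS0]
      rw [this, hSeq]
      refine (norm_sum_le _ _).trans (Finset.sum_le_sum fun n _ ↦ ?_)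
      rw [norm_mul]
    have h2 := Finset.sum_mul_sq_le_sq_mul_sq I (fun n ↦ ‖u n‖) (fun n ↦ ‖H n‖)
    have h0 : 0 ≤ ∑ n ∈ I, ‖u n‖ * ‖H n‖ := Finset.sum_nonneg fun n _ ↦ by positivity
    calc Ssum ^ 2 ≤ (∑ n ∈ I, ‖u n‖ * ‖H n‖) ^ 2 := pow_le_pow_left₀ hS0 h1 2
      _ ≤ _ := h2
  -- `∑_n |H_n|² ≤ ∑_{r,q} |∑_n g_r \bar g_q|`
  have hH2 : ∑ n ∈ I, ‖H n‖ ^ 2 ≤ ∑ r ∈ S, ∑ q ∈ S, ‖∑ n ∈ I, g r n * conj (g q n)‖ := by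
    have e1 : ∀ n, (‖H n‖ ^ 2 : ℝ) = (H n * conj (H n)).re := by
      intro n
      rw [Complex.mul_conj, Complex.normSq_eq_norm_sq]
      norm_cast
    have e2 : ∀ n ∈ I, H n * conj (H n) =
        ∑ r ∈ S, ∑ q ∈ S, (c r * conj (c q)) * (g r n * conj (g q n)) := by
      intro n _
      rw [hH]
      simp only
      rw [map_sum, Finset.sum_mul_sum]
      refine Finset.sum_congr rfl fun r _ ↦ Finset.sum_congr rfl fun q _ ↦ ?_
      rw [map_mul]; ring
    have e3 : ∑ n ∈ I, H n * conj (H n) =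
        ∑ r ∈ S, ∑ q ∈ S, (c r * conj (c q)) * ∑ n ∈ I, g r n * conj (g q n) := by
      rw [Finset.sum_congr rfl e2, Finset.sum_comm]
      refine Finset.sum_congr rfl fun r _ ↦ ?_
      rw [Finset.sum_comm]
      refine Finset.sum_congr rfl fun q _ ↦ ?_
      rw [Finset.mul_sum]
    calc ∑ n ∈ I, ‖H n‖ ^ 2 = ∑ n ∈ I, (H n * conj (H n)).re := Finset.sum_congr rfl fun n _ ↦ e1 n
      _ = (∑ n ∈ I, H n * conj (H n)).re := (Complex.re_sum _ _).symm
      _ = (∑ r ∈ S, ∑ q ∈ S, (c r * conj (c q)) * ∑ n ∈ I, g r n * conj (g q n)).re := by rw [e3]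
      _ ≤ ‖∑ r ∈ S, ∑ q ∈ S, (c r * conj (c q)) * ∑ n ∈ I, g r n * conj (g q n)‖ := Complex.re_le_norm _
      _ ≤ ∑ r ∈ S, ‖∑ q ∈ S, (c r * conj (c q)) * ∑ n ∈ I, g r n * conj (g q n)‖ := norm_sum_le _ _
      _ ≤ ∑ r ∈ S, ∑ q ∈ S, ‖∑ n ∈ I, g r n * conj (g q n)‖ := by
          refine Finset.sum_le_sum fun r _ ↦ (norm_sum_le _ _).trans (Finset.sum_le_sum fun q _ ↦ ?_)
          rw [norm_mul, norm_mul, Complex.norm_conj]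
          have hc : ‖c r‖ * ‖c q‖ ≤ 1 := by
            have := mul_le_mul (hc1 r) (hc1 q) (norm_nonneg _) zero_le_one
            simpa using this
          calc ‖c r‖ * ‖c q‖ * ‖∑ n ∈ I, g r n * conj (g q n)‖
              ≤ 1 * ‖∑ n ∈ I, g r n * conj (g q n)‖ :=
                mul_le_mul_of_nonneg_right hc (norm_nonneg _)
            _ = _ := one_mul _
  have hu0 : 0 ≤ ∑ n ∈ I, ‖u n‖ ^ 2 := Finset.sum_nonneg fun n _ ↦ by positivity
  calc ((S.card : ℝ) * V) ^ 2 ≤ Ssum ^ 2 := pow_le_pow_left₀ (by positivity) hSV 2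
    _ ≤ (∑ n ∈ I, ‖u n‖ ^ 2) * ∑ n ∈ I, ‖H n‖ ^ 2 := hCS
    _ ≤ _ := mul_le_mul_of_nonneg_left hH2 hu0

/-- **Sum of `|t − t'|^{−2}` over a `1`-separated set**: for `t ∈ W`, `W` pairwise `1`-separated,
`∑_{t'∈W, t'≠t} |t−t'|^{−2} ≤ 16` (via `SeparatedSums.sum_kern_le`). [folklore] -/
private theorem sum_inv_sq_sep_le (W : Finset ℝ) (hsep : ∀ t ∈ W, ∀ t' ∈ W, t ≠ t' → 1 ≤ |t - t'|)
    {t : ℝ} (ht : t ∈ W) :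
    ∑ t' ∈ W, (if t ≠ t' then 1 / |t - t'| ^ 2 else 0) ≤ 16 := by
  classical
  have hk := SeparatedSums.sum_kern_le (δ := 1) (ρ := 1) one_pos one_pos W hsep t
  have hle : ∀ t' ∈ W, (if t ≠ t' then 1 / |t - t'| ^ 2 else 0) ≤ SeparatedSums.kern t 1 t' := by
    intro t' ht'
    split_ifs with hne
    · have h1 := hsep t ht t' ht' hne
      unfold SeparatedSums.kern
      rw [if_neg (by rw [abs_sub_comm]; linarith), one_pow, ← sq_abs (t' - t), abs_sub_comm]
    · exact SeparatedSums.kern_nonneg _ _ _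
  calc ∑ t' ∈ W, (if t ≠ t' then 1 / |t - t'| ^ 2 else 0)
      ≤ ∑ t' ∈ W, SeparatedSums.kern t 1 t' := Finset.sum_le_sum hle
    _ ≤ 8 * (1 + 1 / 1) := hk
    _ = 16 := by norm_num

/-! ## §KERNEL-A, part 2: the Gram sums of a weighted piece (Guth–Maynard Lemma 4.5 inputs) -/

section piece

variable {w : ℝ → ℝ}

/-- `\overline{n^{−it}} = n^{it}` for `n ∈ ℕ`. [folklore] -/
private theorem conj_natCast_cpow_neg (n : ℕ) (t : ℝ) :
    conj ((n : ℂ) ^ (-((t : ℂ) * I))) = (n : ℂ) ^ ((t : ℂ) * I) := by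
  have h := congrArg conj (GuthMaynardReduction.conj_natCast_cpow_mul_I n t)
  simpa using h.symm

/-- The Gram entry of the weighted system: for `N' ≥ 1`,
`∑_{N'≤n≤2N'} w(n/N') n^{−it} · \overline{w(n/N') n^{−it'}} = ∑_n w(n/N')² n^{i(t'−t)}`, whose norm is
`N' · |A(t'−t) + B_{N'}(t'−t)|` by Poisson summation (Guth–Maynard Lemma 4.5).
[cite: GuthMaynard2026, Lemma 4.5 (proof)] -/
theorem norm_gram_eq (hw : ContDiff ℝ ∞ w) (hsupp : Function.support w ⊆ Set.Icc 1 2)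
    {N' : ℕ} (hN' : 1 ≤ N') (t t' : ℝ) :
    ‖∑ n ∈ Finset.Icc N' (2 * N'), ((w ((n : ℝ) / N') : ℂ) * (n : ℂ) ^ (-((t : ℂ) * I))) *
        conj (((w ((n : ℝ) / N') : ℂ) * (n : ℂ) ^ (-((t' : ℂ) * I))))‖ =
      (N' : ℝ) * ‖GuthMaynardFourier.coefA w (t' - t) + GuthMaynardFourier.coefB w N' (t' - t)‖ := by
  have hN'0 : (0 : ℝ) < N' := by exact_mod_cast hN'
  have hsum : ∑ n ∈ Finset.Icc N' (2 * N'), ((w ((n : ℝ) / N') : ℂ) * (n : ℂ) ^ (-((t : ℂ) * I))) *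
      conj (((w ((n : ℝ) / N') : ℂ) * (n : ℂ) ^ (-((t' : ℂ) * I)))) =
      ∑ n ∈ Finset.Icc N' (2 * N'), (((w ((n : ℝ) / N')) ^ 2 : ℝ) : ℂ) *
        (n : ℂ) ^ ((((t' - t : ℝ)) : ℂ) * I) := by
    refine Finset.sum_congr rfl fun n hn ↦ ?_
    rw [Finset.mem_Icc] at hn
    have hn0 : (n : ℂ) ≠ 0 := by exact_mod_cast (show n ≠ 0 by omega)
    rw [map_mul, Complex.conj_ofReal, conj_natCast_cpow_neg]
    have e : (n : ℂ) ^ (-((t : ℂ) * I)) * (n : ℂ) ^ ((t' : ℂ) * I) =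
        (n : ℂ) ^ ((((t' - t : ℝ)) : ℂ) * I) := by
      rw [← Complex.cpow_add _ _ hn0]
      congr 1
      push_cast; ring
    calc ((w ((n : ℝ) / N') : ℂ) * (n : ℂ) ^ (-((t : ℂ) * I))) *
          (((w ((n : ℝ) / N') : ℂ)) * (n : ℂ) ^ ((t' : ℂ) * I))
        = ((w ((n : ℝ) / N') : ℂ) * (w ((n : ℝ) / N') : ℂ)) *
            ((n : ℂ) ^ (-((t : ℂ) * I)) * (n : ℂ) ^ ((t' : ℂ) * I)) := by ring
      _ = _ := by rw [e]; push_cast; ring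
  rw [hsum, GuthMaynardFourier.sum_weight_sq_cpow_eq hw hsupp hN' (t' - t),
    ← GuthMaynardFourier.coefA_add_coefB hw hsupp (t' - t) hN'0, norm_mul, norm_mul,
    Complex.norm_natCast_cpow_of_pos (by omega), Complex.norm_natCast]
  simp

/-- **Halász for one weighted piece**: if `w = 1` on `[6/5, 9/5]`, `P ⊂ {n : 6N' ≤ 5n ≤ 9N'}`,
and `|∑_{n∈P} b_n n^{−it}| ≥ V' ≥ 0` on `W'`, then
`(#W'·V')² ≤ (∑_{n∈P}|b_n|²) · ∑_{t,t'∈W'} N'|A(t'−t) + B_{N'}(t'−t)|`.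
[cite: Jutila1977, (3.1), p. 60] [cite: GuthMaynard2026, Section 3 and Lemma 4.5] -/
theorem piece_halasz (hw : ContDiff ℝ ∞ w) (hsupp : Function.support w ⊆ Set.Icc 1 2)
    (hw1 : ∀ u : ℝ, 6 / 5 ≤ u → u ≤ 9 / 5 → w u = 1) {N' : ℕ} (hN' : 1 ≤ N')
    (P : Finset ℕ) (hP : ∀ n ∈ P, 6 * N' ≤ 5 * n ∧ 5 * n ≤ 9 * N') (b : ℕ → ℂ)
    (W' : Finset ℝ) {V' : ℝ} (hV' : 0 ≤ V')
    (hlarge : ∀ t ∈ W', V' ≤ ‖∑ n ∈ P, b n * (n : ℂ) ^ (-((t : ℂ) * I))‖) :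
    ((W'.card : ℝ) * V') ^ 2 ≤ (∑ n ∈ P, ‖b n‖ ^ 2) *
      ∑ t ∈ W', ∑ t' ∈ W', (N' : ℝ) *
        ‖GuthMaynardFourier.coefA w (t' - t) + GuthMaynardFourier.coefB w N' (t' - t)‖ := by
  classical
  set I₀ : Finset ℕ := Finset.Icc N' (2 * N') with hI₀
  set u : ℕ → ℂ := fun n ↦ if n ∈ P then b n else 0 with hu
  set g : ℝ → ℕ → ℂ := fun t n ↦ (w ((n : ℝ) / N') : ℂ) * (n : ℂ) ^ (-((t : ℂ) * I)) with hg
  -- the weighted sum is the piece sum (`w = 1` on the piece)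
  have hsumeq : ∀ t : ℝ, ∑ n ∈ I₀, u n * g t n = ∑ n ∈ P, b n * (n : ℂ) ^ (-((t : ℂ) * I)) := by
    intro t
    have h := GuthMaynardReduction.sum_weight_indicator_eq hw1 hN' P hP b (-t)
    have e1 : ∀ n : ℕ, (n : ℂ) ^ ((((-t : ℝ)) : ℂ) * I) = (n : ℂ) ^ (-((t : ℂ) * I)) := by
      intro n; congr 1; push_cast; ring
    simp_rw [e1] at h
    rw [← h, hI₀]
    refine Finset.sum_congr rfl fun n _ ↦ ?_
    simp only [hu, hg]
    ring
  have hlarge' : ∀ t ∈ W', V' ≤ ‖∑ n ∈ I₀, u n * g t n‖ := by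
    intro t ht; rw [hsumeq]; exact hlarge t ht
  have hH := halasz_finset W' I₀ u g hV' hlarge'
  -- `∑ |u_n|² = ∑_{n∈P} |b_n|²`
  have hPsub : P ⊆ I₀ := by
    intro n hn
    have := hP n hn
    rw [hI₀, Finset.mem_Icc]; omega
  have hu2 : ∑ n ∈ I₀, ‖u n‖ ^ 2 = ∑ n ∈ P, ‖b n‖ ^ 2 := by
    have : ∀ n ∈ I₀, ‖u n‖ ^ 2 = if n ∈ P then ‖b n‖ ^ 2 else 0 := by
      intro n _
      simp only [hu]
      split_ifs <;> simp
    rw [Finset.sum_congr rfl this, Finset.sum_ite_mem, Finset.inter_eq_right.2 hPsub]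
  -- the Gram entries
  have hgram : ∀ t t' : ℝ, ‖∑ n ∈ I₀, g t n * conj (g t' n)‖ =
      (N' : ℝ) * ‖GuthMaynardFourier.coefA w (t' - t) + GuthMaynardFourier.coefB w N' (t' - t)‖ := by
    intro t t'
    rw [hI₀]
    exact norm_gram_eq hw hsupp hN' t t'
  rw [hu2] at hH
  simp_rw [hgram] at hH
  exact hH

/-- **Splitting the Gram sum**: diagonal + `A`-off-diagonal + `B`-off-diagonal. With
`|A(τ)| ≤ c_A`, `|B_{N'}(0)| ≤ c_B` and `|A(τ)| ≤ c₂|τ|^{−2}` (`τ ≠ 0`), for a `1`-separated `W'`: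
`∑_{t,t'} N'|A(t'−t)+B(t'−t)| ≤ N'(c_A + c_B + 16c₂)#W' + N'∑_{t≠t'}|B_{N'}(t−t')|`.
[cite: Jutila1977, §3, p. 60] [cite: GuthMaynard2026, Lemma 4.3] -/
theorem gram_split {N' : ℕ} (hN' : 1 ≤ N') {cA cB c₂ : ℝ}
    (hcA : ∀ τ, ‖GuthMaynardFourier.coefA w τ‖ ≤ cA)
    (hcB : ‖GuthMaynardFourier.coefB w N' 0‖ ≤ cB)
    (hc₂ : ∀ τ, τ ≠ 0 → ‖GuthMaynardFourier.coefA w τ‖ ≤ c₂ / |τ| ^ 2)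
    (W' : Finset ℝ) (hsep : ∀ t ∈ W', ∀ t' ∈ W', t ≠ t' → 1 ≤ |t - t'|) :
    ∑ t ∈ W', ∑ t' ∈ W', (N' : ℝ) *
        ‖GuthMaynardFourier.coefA w (t' - t) + GuthMaynardFourier.coefB w N' (t' - t)‖ ≤
      (N' : ℝ) * ((cA + cB + 16 * c₂) * W'.card) +
        (N' : ℝ) * ∑ t ∈ W', ∑ t' ∈ W',
          (if t ≠ t' then ‖GuthMaynardFourier.coefB w N' (t - t')‖ else 0) := by
  classical
  have hN'0 : (0 : ℝ) < N' := by exact_mod_cast hN'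
  have hc₂0 : 0 ≤ c₂ := by
    have h := hc₂ 1 one_ne_zero
    have : 0 ≤ c₂ / |(1 : ℝ)| ^ 2 := le_trans (norm_nonneg _) h
    simpa using this
  -- pointwise bound
  have hpt : ∀ t ∈ W', ∀ t' ∈ W',
      ‖GuthMaynardFourier.coefA w (t' - t) + GuthMaynardFourier.coefB w N' (t' - t)‖ ≤
        (if t ≠ t' then 0 else cA + cB) + c₂ * (if t ≠ t' then 1 / |t - t'| ^ 2 else 0) +
          (if t ≠ t' then ‖GuthMaynardFourier.coefB w N' (t' - t)‖ else 0) := by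
    intro t ht t' ht'
    by_cases hne : t ≠ t'
    · rw [if_pos hne, if_pos hne, if_pos hne, zero_add]
      have hτ : t' - t ≠ 0 := sub_ne_zero.2 (Ne.symm hne)
      have hA := hc₂ (t' - t) hτ
      calc ‖GuthMaynardFourier.coefA w (t' - t) + GuthMaynardFourier.coefB w N' (t' - t)‖
          ≤ ‖GuthMaynardFourier.coefA w (t' - t)‖ + ‖GuthMaynardFourier.coefB w N' (t' - t)‖ :=
            norm_add_le _ _
        _ ≤ c₂ / |t' - t| ^ 2 + ‖GuthMaynardFourier.coefB w N' (t' - t)‖ := by gcongr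
        _ = c₂ * (1 / |t - t'| ^ 2) + ‖GuthMaynardFourier.coefB w N' (t' - t)‖ := by
            rw [abs_sub_comm]; ring
    · push Not at hne
      subst hne
      rw [if_neg (by simp), if_neg (by simp), if_neg (by simp), sub_self]
      calc ‖GuthMaynardFourier.coefA w 0 + GuthMaynardFourier.coefB w N' 0‖
          ≤ ‖GuthMaynardFourier.coefA w 0‖ + ‖GuthMaynardFourier.coefB w N' 0‖ := norm_add_le _ _
        _ ≤ cA + cB := add_le_add (hcA 0) hcB
        _ = _ := by ring
  have hsum1 : ∑ t ∈ W', ∑ t' ∈ W',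
      ‖GuthMaynardFourier.coefA w (t' - t) + GuthMaynardFourier.coefB w N' (t' - t)‖ ≤
      ∑ t ∈ W', ∑ t' ∈ W', ((if t ≠ t' then 0 else cA + cB) +
        c₂ * (if t ≠ t' then 1 / |t - t'| ^ 2 else 0) +
        (if t ≠ t' then ‖GuthMaynardFourier.coefB w N' (t' - t)‖ else 0)) :=
    Finset.sum_le_sum fun t ht ↦ Finset.sum_le_sum fun t' ht' ↦ hpt t ht t' ht'
  -- evaluate the three sums
  have hdiag : ∀ t ∈ W', ∑ t' ∈ W', (if t ≠ t' then (0 : ℝ) else cA + cB) = cA + cB := by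
    intro t ht
    rw [Finset.sum_ite, Finset.sum_const_zero, zero_add, Finset.sum_const, nsmul_eq_mul]
    have : (W'.filter (fun t' ↦ ¬ t ≠ t')) = {t} := by
      ext t'
      simp only [Finset.mem_filter, ne_eq, not_not, Finset.mem_singleton]
      constructor
      · rintro ⟨-, h⟩; exact h.symm
      · intro h; subst h; exact ⟨ht, rfl⟩
    rw [this, Finset.card_singleton]; simp
  have hAoff : ∀ t ∈ W', ∑ t' ∈ W', c₂ * (if t ≠ t' then 1 / |t - t'| ^ 2 else 0) ≤ c₂ * 16 := by
    intro t ht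
    rw [← Finset.mul_sum]
    exact mul_le_mul_of_nonneg_left (sum_inv_sq_sep_le W' hsep ht) hc₂0
  have hBoff : ∑ t ∈ W', ∑ t' ∈ W', (if t ≠ t' then ‖GuthMaynardFourier.coefB w N' (t' - t)‖ else 0) =
      ∑ t ∈ W', ∑ t' ∈ W', (if t ≠ t' then ‖GuthMaynardFourier.coefB w N' (t - t')‖ else 0) := by
    rw [Finset.sum_comm]
    refine Finset.sum_congr rfl fun t _ ↦ Finset.sum_congr rfl fun t' _ ↦ ?_
    by_cases h : t = t'
    · subst h; simp
    · rw [if_pos (Ne.symm h), if_pos h]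
  have htot : ∑ t ∈ W', ∑ t' ∈ W', ((if t ≠ t' then 0 else cA + cB) +
        c₂ * (if t ≠ t' then 1 / |t - t'| ^ 2 else 0) +
        (if t ≠ t' then ‖GuthMaynardFourier.coefB w N' (t' - t)‖ else 0)) ≤
      (cA + cB + 16 * c₂) * W'.card +
        ∑ t ∈ W', ∑ t' ∈ W', (if t ≠ t' then ‖GuthMaynardFourier.coefB w N' (t - t')‖ else 0) := by
    have e : ∑ t ∈ W', ∑ t' ∈ W', ((if t ≠ t' then 0 else cA + cB) +
        c₂ * (if t ≠ t' then 1 / |t - t'| ^ 2 else 0) +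
        (if t ≠ t' then ‖GuthMaynardFourier.coefB w N' (t' - t)‖ else 0)) =
        ∑ t ∈ W', (∑ t' ∈ W', (if t ≠ t' then (0 : ℝ) else cA + cB)) +
        ∑ t ∈ W', (∑ t' ∈ W', c₂ * (if t ≠ t' then 1 / |t - t'| ^ 2 else 0)) +
        ∑ t ∈ W', ∑ t' ∈ W', (if t ≠ t' then ‖GuthMaynardFourier.coefB w N' (t' - t)‖ else 0) := by
      rw [← Finset.sum_add_distrib, ← Finset.sum_add_distrib]
      refine Finset.sum_congr rfl fun t _ ↦ ?_
      rw [← Finset.sum_add_distrib, ← Finset.sum_add_distrib]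
    rw [e, hBoff, Finset.sum_congr rfl hdiag, Finset.sum_const, nsmul_eq_mul]
    have h2 : ∑ t ∈ W', (∑ t' ∈ W', c₂ * (if t ≠ t' then 1 / |t - t'| ^ 2 else 0)) ≤
        W'.card * (c₂ * 16) := by
      calc ∑ t ∈ W', (∑ t' ∈ W', c₂ * (if t ≠ t' then 1 / |t - t'| ^ 2 else 0))
          ≤ ∑ _t ∈ W', c₂ * 16 := Finset.sum_le_sum hAoff
        _ = W'.card * (c₂ * 16) := by rw [Finset.sum_const, nsmul_eq_mul]
    nlinarith [h2]
  calc ∑ t ∈ W', ∑ t' ∈ W', (N' : ℝ) *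
        ‖GuthMaynardFourier.coefA w (t' - t) + GuthMaynardFourier.coefB w N' (t' - t)‖
      = (N' : ℝ) * ∑ t ∈ W', ∑ t' ∈ W',
          ‖GuthMaynardFourier.coefA w (t' - t) + GuthMaynardFourier.coefB w N' (t' - t)‖ := by
        rw [Finset.mul_sum]
        refine Finset.sum_congr rfl fun t _ ↦ ?_
        rw [Finset.mul_sum]
    _ ≤ (N' : ℝ) * ((cA + cB + 16 * c₂) * W'.card +
        ∑ t ∈ W', ∑ t' ∈ W', (if t ≠ t' then ‖GuthMaynardFourier.coefB w N' (t - t')‖ else 0)) :=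
        mul_le_mul_of_nonneg_left (hsum1.trans htot) hN'0.le
    _ = _ := by ring

end piece

/-! ## §KERNEL-A, part 3: the count on one piece (Halász + Gram split + pair bound + solve) -/

section count

variable {w : ℝ → ℝ}

/-- `max 1 (x·L) ≤ max 1 x · L` for `x ≥ 0`, `L ≥ 1`. [folklore] -/
private lemma max_one_mul_le {x L : ℝ} (hL : 1 ≤ L) :
    max 1 (x * L) ≤ max 1 x * L := by
  rcases le_or_gt (x * L) 1 with h | h
  · rw [max_eq_left h]
    calc (1 : ℝ) = 1 * 1 := by ring
      _ ≤ max 1 x * L := mul_le_mul (le_max_left _ _) hL zero_le_one (by positivity)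
  · rw [max_eq_right h.le]
    exact mul_le_mul_of_nonneg_right (le_max_right _ _) (by linarith)

set_option maxHeartbeats 800000 in
/-- **The count on one weighted piece** (Jutila §3 for `q = 1` at `σ = 0`, one piece of the
three-pieces decomposition): Halász's inequality for the piece (`piece_halasz`), the Gram split
(`gram_split`), the pair-correlation bound for the `B`-part (hypothesis `hBW`, the instantiated
KERNEL-B statement) and `R_le_of_holder_bound` give
`#W' ≤ (3·max(1, c_A+c_B+16c₂+C_B))^{4k} (T^ε)^{4k} (G_P N' V'^{−2} + T(G_P⁴N'²V'^{−8})^k + (T G_P² V'^{−4})^k)`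
with `G_P = ∑_{n∈P}|b_n|²`. [cite: Jutila1977, §3, proof of (1.2), p. 60] -/
theorem piece_count (hw : ContDiff ℝ ∞ w) (hsupp : Function.support w ⊆ Set.Icc 1 2)
    (hw1 : ∀ u : ℝ, 6 / 5 ≤ u → u ≤ 9 / 5 → w u = 1) {k : ℕ} (hk : 1 ≤ k)
    {N' : ℕ} (hN' : 1 ≤ N') (P : Finset ℕ) (hP : ∀ n ∈ P, 6 * N' ≤ 5 * n ∧ 5 * n ≤ 9 * N')
    (b : ℕ → ℂ) (W' : Finset ℝ) (hsep : ∀ t ∈ W', ∀ t' ∈ W', t ≠ t' → 1 ≤ |t - t'|)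
    {V' : ℝ} (hV' : 0 < V')
    (hlarge : ∀ t ∈ W', V' ≤ ‖∑ n ∈ P, b n * (n : ℂ) ^ (-((t : ℂ) * I))‖)
    {T ε : ℝ} (hT : 1 ≤ T) (hε : 0 ≤ ε) {cA cB c₂ CB : ℝ}
    (hcA : ∀ τ, ‖GuthMaynardFourier.coefA w τ‖ ≤ cA)
    (hcB : ‖GuthMaynardFourier.coefB w N' 0‖ ≤ cB)
    (hc₂ : ∀ τ, τ ≠ 0 → ‖GuthMaynardFourier.coefA w τ‖ ≤ c₂ / |τ| ^ 2) (hCB0 : 0 ≤ CB)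
    (hBW : (N' : ℝ) * ∑ t ∈ W', ∑ t' ∈ W',
        (if t ≠ t' then ‖GuthMaynardFourier.coefB w N' (t - t')‖ else 0) ≤
      CB * T ^ ε * ((W'.card : ℝ) + (N' : ℝ) ^ (1 / 2 : ℝ) * (W'.card : ℝ) ^ (2 - 1 / (k : ℝ)) *
        ((W'.card : ℝ) * ((T / N') ^ k + ((W'.card : ℝ) * T) ^ (1 / 2 : ℝ))) ^ (1 / (2 * (k : ℝ))))) :
    (W'.card : ℝ) ≤ (3 * max 1 (cA + cB + 16 * c₂ + CB)) ^ (4 * k) * (T ^ ε) ^ (4 * k) *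
      ((∑ n ∈ P, ‖b n‖ ^ 2) * N' * V' ^ (-2 : ℝ) +
        T * ((∑ n ∈ P, ‖b n‖ ^ 2) ^ 4 * (N' : ℝ) ^ 2 * V' ^ (-8 : ℝ)) ^ k +
        (T * ((∑ n ∈ P, ‖b n‖ ^ 2) ^ 2 * V' ^ (-4 : ℝ))) ^ k) := by
  have hN'0 : (0 : ℝ) < N' := by exact_mod_cast hN'
  have hN'1 : (1 : ℝ) ≤ N' := by exact_mod_cast hN'
  have hT0 : 0 < T := by linarith
  have hTε : 1 ≤ T ^ ε := Real.one_le_rpow hT hε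
  set G : ℝ := ∑ n ∈ P, ‖b n‖ ^ 2 with hG
  have hG0 : 0 ≤ G := Finset.sum_nonneg fun n _ ↦ by positivity
  set R : ℝ := (W'.card : ℝ) with hR
  have hR0 : 0 ≤ R := by positivity
  -- the constants are nonnegative
  have hcA0 : 0 ≤ cA := le_trans (norm_nonneg _) (hcA 0)
  have hcB0 : 0 ≤ cB := le_trans (norm_nonneg _) hcB
  have hc₂0 : 0 ≤ c₂ := by
    have h := hc₂ 1 one_ne_zero
    have : 0 ≤ c₂ / |(1 : ℝ)| ^ 2 := le_trans (norm_nonneg _) h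
    simpa using this
  set c : ℝ := cA + cB + 16 * c₂ with hc
  have hc0 : 0 ≤ c := by positivity
  -- Halász + Gram split + pair bound
  have h1 := piece_halasz hw hsupp hw1 hN' P hP b W' hV'.le hlarge
  have h2 := gram_split (w := w) hN' hcA hcB hc₂ W' hsep
  set Y : ℝ := (R * ((T / N') ^ k + (R * T) ^ (1 / 2 : ℝ))) ^ (1 / (2 * (k : ℝ))) with hY
  have hY0 : 0 ≤ Y := by positivity
  set Z : ℝ := (N' : ℝ) ^ (1 / 2 : ℝ) * R ^ (2 - 1 / (k : ℝ)) * Y with hZ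
  have hZ0 : 0 ≤ Z := by positivity
  have h3 : (N' : ℝ) * ∑ t ∈ W', ∑ t' ∈ W',
      (if t ≠ t' then ‖GuthMaynardFourier.coefB w N' (t - t')‖ else 0) ≤ CB * T ^ ε * (R + Z) := by
    rw [hZ, hY, hR]; exact hBW
  have hmain : R ^ 2 * V' ^ 2 ≤ (c + CB) * T ^ ε * (G * R * N' + G * (N' : ℝ) ^ (1 / 2 : ℝ) * 1 *
      R ^ (2 - 1 / (k : ℝ)) * (R * ((T / N') ^ k + (R * T) ^ (1 / 2 : ℝ))) ^ (1 / (2 * (k : ℝ)))) := by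
    have e0 : R ^ 2 * V' ^ 2 = (R * V') ^ 2 := by ring
    rw [e0]
    have hstep : (R * V') ^ 2 ≤ G * ((N' : ℝ) * (c * R) + CB * T ^ ε * (R + Z)) := by
      calc (R * V') ^ 2 ≤ G * ∑ t ∈ W', ∑ t' ∈ W', (N' : ℝ) *
            ‖GuthMaynardFourier.coefA w (t' - t) + GuthMaynardFourier.coefB w N' (t' - t)‖ := h1
        _ ≤ G * ((N' : ℝ) * (c * R) + (N' : ℝ) * ∑ t ∈ W', ∑ t' ∈ W',
              (if t ≠ t' then ‖GuthMaynardFourier.coefB w N' (t - t')‖ else 0)) := by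
            rw [hc, hR]; exact mul_le_mul_of_nonneg_left h2 hG0
        _ ≤ G * ((N' : ℝ) * (c * R) + CB * T ^ ε * (R + Z)) := by gcongr
    -- compare term by term
    have t1 : G * ((N' : ℝ) * (c * R)) ≤ c * T ^ ε * (G * R * N') := by
      have : G * ((N' : ℝ) * (c * R)) = c * 1 * (G * R * N') := by ring
      rw [this]
      exact mul_le_mul_of_nonneg_right (mul_le_mul_of_nonneg_left hTε hc0) (by positivity)
    have t2 : G * (CB * T ^ ε * R) ≤ CB * T ^ ε * (G * R * N') := by
      have : G * (CB * T ^ ε * R) = CB * T ^ ε * (G * R * 1) := by ring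
      rw [this]
      exact mul_le_mul_of_nonneg_left (mul_le_mul_of_nonneg_left hN'1 (by positivity))
        (by positivity)
    have t3 : G * (CB * T ^ ε * Z) ≤ (c + CB) * T ^ ε * (G * Z) := by
      have : G * (CB * T ^ ε * Z) = CB * T ^ ε * (G * Z) := by ring
      rw [this]
      exact mul_le_mul_of_nonneg_right (mul_le_mul_of_nonneg_right (by linarith) (by positivity))
        (by positivity)
    have e1 : G * ((N' : ℝ) * (c * R) + CB * T ^ ε * (R + Z)) =
        G * ((N' : ℝ) * (c * R)) + G * (CB * T ^ ε * R) + G * (CB * T ^ ε * Z) := by ring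
    have e2 : (c + CB) * T ^ ε * (G * R * N' + G * (N' : ℝ) ^ (1 / 2 : ℝ) * 1 *
        R ^ (2 - 1 / (k : ℝ)) * (R * ((T / N') ^ k + (R * T) ^ (1 / 2 : ℝ))) ^ (1 / (2 * (k : ℝ)))) =
        c * T ^ ε * (G * R * N') + CB * T ^ ε * (G * R * N') + (c + CB) * T ^ ε * (G * Z) := by
      rw [hZ, hY]; ring
    rw [e2]
    linarith [hstep, t1, t2, t3, e1]
  have hsolve := R_le_of_holder_bound (R := R) (V := V') (G := G) (N := (N' : ℝ)) (T := T) (L := 1)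
    (C := (c + CB) * T ^ ε) hk hR0 hV' hG0 hN'0 hT0 le_rfl (by positivity) hmain
  -- the constant
  have hconst : (3 * max 1 ((c + CB) * T ^ ε) * 1) ^ (4 * k) ≤
      (3 * max 1 (c + CB)) ^ (4 * k) * (T ^ ε) ^ (4 * k) := by
    rw [← mul_pow]
    apply pow_le_pow_left₀ (by positivity)
    rw [mul_one]
    have := max_one_mul_le (x := c + CB) (L := T ^ ε) hTε
    nlinarith [this]
  have hX0 : 0 ≤ G * N' * V' ^ (-2 : ℝ) + T * (G ^ 4 * (N' : ℝ) ^ 2 * V' ^ (-8 : ℝ)) ^ k +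
      (T * (G ^ 2 * V' ^ (-4 : ℝ))) ^ k := by positivity
  calc R ≤ (3 * max 1 ((c + CB) * T ^ ε) * 1) ^ (4 * k) *
        (G * N' * V' ^ (-2 : ℝ) + T * (G ^ 4 * (N' : ℝ) ^ 2 * V' ^ (-8 : ℝ)) ^ k +
          (T * (G ^ 2 * V' ^ (-4 : ℝ))) ^ k) := hsolve
    _ ≤ (3 * max 1 (c + CB)) ^ (4 * k) * (T ^ ε) ^ (4 * k) *
        (G * N' * V' ^ (-2 : ℝ) + T * (G ^ 4 * (N' : ℝ) ^ 2 * V' ^ (-8 : ℝ)) ^ k +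
          (T * (G ^ 2 * V' ^ (-4 : ℝ))) ^ k) := mul_le_mul_of_nonneg_right hconst hX0
    _ = _ := by rw [hc]

end count

/-! ## §KERNEL-A, part 4: the three pieces and the main range `N ≥ N₁`, `1 ≤ T ≤ (N/2)^A` -/

section mainrange

variable {w : ℝ → ℝ}

/-- `(V/3)^{−r} = 3^r V^{−r}` (`V ≥ 0`). [folklore] -/
private lemma div_three_rpow_neg {V : ℝ} (hV : 0 ≤ V) (r : ℝ) :
    (V / 3) ^ (-r) = (3 : ℝ) ^ r * V ^ (-r) := by
  rw [Real.div_rpow hV (by norm_num), Real.rpow_neg (by norm_num : (0 : ℝ) ≤ 3), div_eq_mul_inv,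
    inv_inv, mul_comm]

/-- Conversion of the piece bound to the printed three terms: `G_P ≤ G`, `N' ≤ 2N`, `V' = V/3`
cost at most the factor `(4·3⁸)^k`. [folklore] -/
private lemma convert_piece {G_P G Nr N'r V T : ℝ} {k : ℕ} (hk : 1 ≤ k) (hGP0 : 0 ≤ G_P)
    (hGP : G_P ≤ G) (hN'0 : 0 ≤ N'r) (hN'2 : N'r ≤ 2 * Nr) (hV : 0 < V) (hT : 0 ≤ T) :
    G_P * N'r * (V / 3) ^ (-2 : ℝ) + T * (G_P ^ 4 * N'r ^ 2 * (V / 3) ^ (-8 : ℝ)) ^ k +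
        (T * (G_P ^ 2 * (V / 3) ^ (-4 : ℝ))) ^ k ≤
      (4 * 3 ^ 8 : ℝ) ^ k * (G * Nr * V ^ (-2 : ℝ) + T * (G ^ 4 * Nr ^ 2 * V ^ (-8 : ℝ)) ^ k +
        (T * G ^ 2 * V ^ (-4 : ℝ)) ^ k) := by
  have hG0 : 0 ≤ G := hGP0.trans hGP
  have hNr0 : 0 ≤ Nr := by linarith
  have e2 : (V / 3) ^ (-2 : ℝ) = 9 * V ^ (-2 : ℝ) := by
    rw [show (-2 : ℝ) = -(2 : ℝ) by ring, div_three_rpow_neg hV.le]; norm_num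
  have e4 : (V / 3) ^ (-4 : ℝ) = 81 * V ^ (-4 : ℝ) := by
    rw [show (-4 : ℝ) = -(4 : ℝ) by ring, div_three_rpow_neg hV.le]; norm_num
  have e8 : (V / 3) ^ (-8 : ℝ) = 3 ^ 8 * V ^ (-8 : ℝ) := by
    rw [show (-8 : ℝ) = -(8 : ℝ) by ring, div_three_rpow_neg hV.le]; norm_num
  rw [e2, e4, e8]
  have hV2 : 0 ≤ V ^ (-2 : ℝ) := by positivity
  have hV4 : 0 ≤ V ^ (-4 : ℝ) := by positivity
  have hV8 : 0 ≤ V ^ (-8 : ℝ) := by positivity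
  set q : ℝ := (4 * 3 ^ 8 : ℝ) ^ k with hq
  have hq1 : (4 * 3 ^ 8 : ℝ) ≤ q := by
    calc (4 * 3 ^ 8 : ℝ) = (4 * 3 ^ 8 : ℝ) ^ 1 := (pow_one _).symm
      _ ≤ q := pow_le_pow_right₀ (by norm_num) hk
  have hq18 : (18 : ℝ) ≤ q := by linarith
  have hq81 : (81 : ℝ) ^ k ≤ q := pow_le_pow_left₀ (by norm_num) (by norm_num) k
  -- term 1
  have t1 : G_P * N'r * (9 * V ^ (-2 : ℝ)) ≤ q * (G * Nr * V ^ (-2 : ℝ)) := by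
    calc G_P * N'r * (9 * V ^ (-2 : ℝ)) ≤ G * (2 * Nr) * (9 * V ^ (-2 : ℝ)) := by gcongr
      _ = 18 * (G * Nr * V ^ (-2 : ℝ)) := by ring
      _ ≤ q * (G * Nr * V ^ (-2 : ℝ)) := mul_le_mul_of_nonneg_right hq18 (by positivity)
  -- term 2
  have t2 : T * (G_P ^ 4 * N'r ^ 2 * (3 ^ 8 * V ^ (-8 : ℝ))) ^ k ≤
      q * (T * (G ^ 4 * Nr ^ 2 * V ^ (-8 : ℝ)) ^ k) := by
    have h1 : G_P ^ 4 * N'r ^ 2 * (3 ^ 8 * V ^ (-8 : ℝ)) ≤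
        (4 * 3 ^ 8) * (G ^ 4 * Nr ^ 2 * V ^ (-8 : ℝ)) := by
      calc G_P ^ 4 * N'r ^ 2 * (3 ^ 8 * V ^ (-8 : ℝ)) ≤ G ^ 4 * (2 * Nr) ^ 2 * (3 ^ 8 * V ^ (-8 : ℝ)) := by
            gcongr
        _ = (4 * 3 ^ 8) * (G ^ 4 * Nr ^ 2 * V ^ (-8 : ℝ)) := by ring
    calc T * (G_P ^ 4 * N'r ^ 2 * (3 ^ 8 * V ^ (-8 : ℝ))) ^ k
        ≤ T * ((4 * 3 ^ 8) * (G ^ 4 * Nr ^ 2 * V ^ (-8 : ℝ))) ^ k := by gcongr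
      _ = q * (T * (G ^ 4 * Nr ^ 2 * V ^ (-8 : ℝ)) ^ k) := by rw [mul_pow, hq]; ring
  -- term 3
  have t3 : (T * (G_P ^ 2 * (81 * V ^ (-4 : ℝ)))) ^ k ≤ q * (T * G ^ 2 * V ^ (-4 : ℝ)) ^ k := by
    calc (T * (G_P ^ 2 * (81 * V ^ (-4 : ℝ)))) ^ k ≤ (T * (G ^ 2 * (81 * V ^ (-4 : ℝ)))) ^ k := by
          gcongr
      _ = 81 ^ k * (T * G ^ 2 * V ^ (-4 : ℝ)) ^ k := by rw [← mul_pow]; ring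
      _ ≤ q * (T * G ^ 2 * V ^ (-4 : ℝ)) ^ k := mul_le_mul_of_nonneg_right hq81 (by positivity)
  calc G_P * N'r * (9 * V ^ (-2 : ℝ)) + T * (G_P ^ 4 * N'r ^ 2 * (3 ^ 8 * V ^ (-8 : ℝ))) ^ k +
        (T * (G_P ^ 2 * (81 * V ^ (-4 : ℝ)))) ^ k
      ≤ q * (G * Nr * V ^ (-2 : ℝ)) + q * (T * (G ^ 4 * Nr ^ 2 * V ^ (-8 : ℝ)) ^ k) +
          q * (T * G ^ 2 * V ^ (-4 : ℝ)) ^ k := add_le_add (add_le_add t1 t2) t3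
    _ = _ := by ring

set_option maxHeartbeats 1600000 in
/-- **The main range of the kernel** (Jutila §3, `q = 1`, `σ = 0`): for `N ≥ 8` with `N/2 ≥ N₀`
and `1 ≤ T ≤ (N/2)^A`, splitting the block `(N, 2N]` into the three Guth–Maynard pieces
(`N' = ⌊5N/6⌋, N, ⌊(10N+8)/9⌋`, each inside `[6N'/5, 9N'/5]` where `w = 1`), one of which carries a
third of the large value at each point, and applying `piece_count` to each piece:
`#W ≤ 3 (3·max(1,c))^{4k} (4·3⁸)^k (T^ε)^{4k} (GNV^{−2} + T(G⁴N²V^{−8})^k + (TG²V^{−4})^k)`.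
[cite: Jutila1977, §3, proof of (1.2), p. 60] [cite: GuthMaynard2026, Section 3] -/
theorem core_main (hw : ContDiff ℝ ∞ w) (hsupp : Function.support w ⊆ Set.Icc 1 2)
    (hw1 : ∀ u : ℝ, 6 / 5 ≤ u → u ≤ 9 / 5 → w u = 1) {k : ℕ} (hk : 1 ≤ k)
    {ε A CB N₀ cA cB c₂ : ℝ} (hε : 0 ≤ ε) (hA : 0 ≤ A) (hCB0 : 0 ≤ CB)
    (hcA : ∀ τ, ‖GuthMaynardFourier.coefA w τ‖ ≤ cA)
    (hcB : ∀ N' : ℕ, 1 ≤ N' → ‖GuthMaynardFourier.coefB w N' 0‖ ≤ cB)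
    (hc₂ : ∀ τ, τ ≠ 0 → ‖GuthMaynardFourier.coefA w τ‖ ≤ c₂ / |τ| ^ 2)
    (hBN : ∀ N' : ℕ, N₀ ≤ (N' : ℝ) → ∀ T : ℝ, 1 ≤ T → T ≤ (N' : ℝ) ^ A → ∀ W' : Finset ℝ,
      (∀ t ∈ W', ∀ t' ∈ W', |t - t'| ≤ T) → (∀ t ∈ W', ∀ t' ∈ W', t ≠ t' → 1 ≤ |t - t'|) →
      (N' : ℝ) * ∑ t ∈ W', ∑ t' ∈ W',
          (if t ≠ t' then ‖GuthMaynardFourier.coefB w N' (t - t')‖ else 0) ≤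
        CB * T ^ ε * ((W'.card : ℝ) + (N' : ℝ) ^ (1 / 2 : ℝ) * (W'.card : ℝ) ^ (2 - 1 / (k : ℝ)) *
          ((W'.card : ℝ) * ((T / N') ^ k + ((W'.card : ℝ) * T) ^ (1 / 2 : ℝ))) ^ (1 / (2 * (k : ℝ)))))
    (N : ℕ) (T V : ℝ) (a : ℕ → ℂ) (W : Finset ℝ) (hN8 : 8 ≤ N) (hNN₀ : N₀ ≤ (N : ℝ) / 2)
    (hT1 : 1 ≤ T) (hTA : T ≤ ((N : ℝ) / 2) ^ A) (hV : 0 < V)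
    (hwin : ∀ t ∈ W, ∀ t' ∈ W, |t - t'| ≤ T)
    (hsep : ∀ t ∈ W, ∀ t' ∈ W, t ≠ t' → 1 ≤ |t - t'|)
    (hlarge : ∀ t ∈ W, V ≤ ‖∑ n ∈ Finset.Ioc N (2 * N), a n * (n : ℂ) ^ (-((t : ℂ) * I))‖) :
    (W.card : ℝ) ≤ 3 * ((3 * max 1 (cA + cB + 16 * c₂ + CB)) ^ (4 * k) * (4 * 3 ^ 8 : ℝ) ^ k) *
      (T ^ ε) ^ (4 * k) * (jutilaG a N * N * V ^ (-2 : ℝ) +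
        T * (jutilaG a N ^ 4 * (N : ℝ) ^ 2 * V ^ (-8 : ℝ)) ^ k +
        (T * jutilaG a N ^ 2 * V ^ (-4 : ℝ)) ^ k) := by
  classical
  have hN1 : 1 ≤ N := by omega
  have hNr8 : (8 : ℝ) ≤ N := by exact_mod_cast hN8
  have hNr0 : (0 : ℝ) < N := by linarith
  have hT0 : 0 ≤ T := by linarith
  set G : ℝ := jutilaG a N with hGdef
  have hG0 : 0 ≤ G := jutilaG_nonneg a N
  set K₁ : ℝ := (3 * max 1 (cA + cB + 16 * c₂ + CB)) ^ (4 * k) with hK₁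
  have hK₁0 : 0 ≤ K₁ := by positivity
  set q : ℝ := (4 * 3 ^ 8 : ℝ) ^ k with hq
  set X : ℝ := G * N * V ^ (-2 : ℝ) + T * (G ^ 4 * (N : ℝ) ^ 2 * V ^ (-8 : ℝ)) ^ k +
    (T * G ^ 2 * V ^ (-4 : ℝ)) ^ k with hX
  have hX0 : 0 ≤ X := by positivity
  have hTε0 : 0 ≤ (T ^ ε) ^ (4 * k) := by positivity
  -- the extended coefficients on `[N, 2N]`
  set a' : ℕ → ℂ := fun n ↦ if n ∈ Finset.Ioc N (2 * N) then a n else 0 with ha'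
  have hsumIcc : ∀ t : ℝ, ∑ n ∈ Finset.Ioc N (2 * N), a n * (n : ℂ) ^ (-((t : ℂ) * I)) =
      ∑ n ∈ Finset.Icc N (2 * N), a' n * (n : ℂ) ^ (-((t : ℂ) * I)) := by
    intro t
    have hsub : Finset.Ioc N (2 * N) ⊆ Finset.Icc N (2 * N) := fun n hn ↦ by
      rw [Finset.mem_Ioc] at hn; rw [Finset.mem_Icc]; omega
    rw [← Finset.sum_subset hsub (fun n _ hn ↦ by simp only [ha']; rw [if_neg hn, zero_mul])]
    exact Finset.sum_congr rfl fun n hn ↦ by simp only [ha']; rw [if_pos hn]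
  have hG'le : ∀ P : Finset ℕ, P ⊆ Finset.Icc N (2 * N) → ∑ n ∈ P, ‖a' n‖ ^ 2 ≤ G := by
    intro P hP
    have h1 : ∑ n ∈ P, ‖a' n‖ ^ 2 ≤ ∑ n ∈ Finset.Icc N (2 * N), ‖a' n‖ ^ 2 :=
      Finset.sum_le_sum_of_subset_of_nonneg hP fun n _ _ ↦ by positivity
    have h2 : ∑ n ∈ Finset.Icc N (2 * N), ‖a' n‖ ^ 2 = G := by
      rw [hGdef, jutilaG]
      have hsub : Finset.Ioc N (2 * N) ⊆ Finset.Icc N (2 * N) := fun n hn ↦ by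
        rw [Finset.mem_Ioc] at hn; rw [Finset.mem_Icc]; omega
      rw [← Finset.sum_subset hsub (fun n _ hn ↦ by simp only [ha']; rw [if_neg hn]; simp)]
      exact Finset.sum_congr rfl fun n hn ↦ by simp only [ha']; rw [if_pos hn]
    linarith
  -- the three pieces
  set P₁ := (Finset.Icc N (2 * N)).filter (fun n ↦ 5 * n < 6 * N) with hP₁
  set P₂ := (Finset.Icc N (2 * N)).filter (fun n ↦ 6 * N ≤ 5 * n ∧ 5 * n ≤ 9 * N) with hP₂
  set P₃ := (Finset.Icc N (2 * N)).filter (fun n ↦ 9 * N < 5 * n) with hP₃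
  have hP₁' : ∀ n ∈ P₁, 6 * (5 * N / 6) ≤ 5 * n ∧ 5 * n ≤ 9 * (5 * N / 6) := by
    intro n hn
    rw [hP₁, Finset.mem_filter, Finset.mem_Icc] at hn
    omega
  have hP₂' : ∀ n ∈ P₂, 6 * N ≤ 5 * n ∧ 5 * n ≤ 9 * N := by
    intro n hn
    rw [hP₂, Finset.mem_filter, Finset.mem_Icc] at hn
    omega
  have hP₃' : ∀ n ∈ P₃, 6 * ((10 * N + 8) / 9) ≤ 5 * n ∧ 5 * n ≤ 9 * ((10 * N + 8) / 9) := by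
    intro n hn
    rw [hP₃, Finset.mem_filter, Finset.mem_Icc] at hn
    omega
  have hPsub : ∀ i, i = P₁ ∨ i = P₂ ∨ i = P₃ → i ⊆ Finset.Icc N (2 * N) := by
    rintro i (rfl | rfl | rfl) <;> exact Finset.filter_subset _ _
  -- the generic piece bound
  have hpiece : ∀ (P : Finset ℕ) (N' : ℕ), P ⊆ Finset.Icc N (2 * N) →
      (∀ n ∈ P, 6 * N' ≤ 5 * n ∧ 5 * n ≤ 9 * N') → 1 ≤ N' → N ≤ 2 * N' → N' ≤ 2 * N →
      ((W.filter (fun t : ℝ ↦ V / 3 ≤ ‖∑ n ∈ P, a' n * (n : ℂ) ^ (-((t : ℂ) * I))‖)).card : ℝ) ≤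
        K₁ * q * (T ^ ε) ^ (4 * k) * X := by
    intro P N' hPI hP hN'1 hNN' hN'N
    set WP := W.filter (fun t : ℝ ↦ V / 3 ≤ ‖∑ n ∈ P, a' n * (n : ℂ) ^ (-((t : ℂ) * I))‖) with hWP
    have hWPW : WP ⊆ W := Finset.filter_subset _ _
    have hN'r1 : (1 : ℝ) ≤ N' := by exact_mod_cast hN'1
    have hN'half : (N : ℝ) / 2 ≤ N' := by
      have : (N : ℝ) ≤ 2 * N' := by exact_mod_cast hNN'
      linarith
    have hN'2N : (N' : ℝ) ≤ 2 * N := by exact_mod_cast hN'N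
    have hN₀N' : N₀ ≤ (N' : ℝ) := hNN₀.trans hN'half
    have hTN' : T ≤ (N' : ℝ) ^ A :=
      hTA.trans (Real.rpow_le_rpow (by positivity) hN'half hA)
    have hBW := hBN N' hN₀N' T hT1 hTN' WP (fun t ht t' ht' ↦ hwin t (hWPW ht) t' (hWPW ht'))
      (fun t ht t' ht' hne ↦ hsep t (hWPW ht) t' (hWPW ht') hne)
    have hlargeP : ∀ t ∈ WP, V / 3 ≤ ‖∑ n ∈ P, a' n * (n : ℂ) ^ (-((t : ℂ) * I))‖ := by
      intro t ht; rw [hWP, Finset.mem_filter] at ht; exact ht.2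
    have hcount := piece_count hw hsupp hw1 hk hN'1 P hP a' WP
      (fun t ht t' ht' hne ↦ hsep t (hWPW ht) t' (hWPW ht') hne) (by positivity : 0 < V / 3)
      hlargeP hT1 hε hcA (hcB N' hN'1) hc₂ hCB0 hBW
    have hconv := convert_piece (T := T) hk (Finset.sum_nonneg fun n _ ↦ by positivity)
      (hG'le P hPI) (by positivity : (0 : ℝ) ≤ N') hN'2N hV hT0
    calc (WP.card : ℝ) ≤ K₁ * (T ^ ε) ^ (4 * k) *
          ((∑ n ∈ P, ‖a' n‖ ^ 2) * N' * (V / 3) ^ (-2 : ℝ) +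
            T * ((∑ n ∈ P, ‖a' n‖ ^ 2) ^ 4 * (N' : ℝ) ^ 2 * (V / 3) ^ (-8 : ℝ)) ^ k +
            (T * ((∑ n ∈ P, ‖a' n‖ ^ 2) ^ 2 * (V / 3) ^ (-4 : ℝ))) ^ k) := hcount
      _ ≤ K₁ * (T ^ ε) ^ (4 * k) * (q * X) := by
          rw [hq, hX]
          exact mul_le_mul_of_nonneg_left hconv (by positivity)
      _ = K₁ * q * (T ^ ε) ^ (4 * k) * X := by ring
  have h1 := hpiece P₁ (5 * N / 6) (hPsub _ (Or.inl rfl)) hP₁' (by omega) (by omega) (by omega)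
  have h2 := hpiece P₂ N (hPsub _ (Or.inr (Or.inl rfl))) hP₂' hN1 (by omega) (by omega)
  have h3 := hpiece P₃ ((10 * N + 8) / 9) (hPsub _ (Or.inr (Or.inr rfl))) hP₃' (by omega)
    (by omega) (by omega)
  -- the cover
  set W₁ := W.filter (fun t : ℝ ↦ V / 3 ≤ ‖∑ n ∈ P₁, a' n * (n : ℂ) ^ (-((t : ℂ) * I))‖) with hW₁
  set W₂ := W.filter (fun t : ℝ ↦ V / 3 ≤ ‖∑ n ∈ P₂, a' n * (n : ℂ) ^ (-((t : ℂ) * I))‖) with hW₂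
  set W₃ := W.filter (fun t : ℝ ↦ V / 3 ≤ ‖∑ n ∈ P₃, a' n * (n : ℂ) ^ (-((t : ℂ) * I))‖) with hW₃
  have hcover : W ⊆ W₁ ∪ W₂ ∪ W₃ := by
    intro t ht
    have hsplit := GuthMaynardReduction.norm_sum_Icc_le_three_pieces N
      (fun n ↦ a' n * (n : ℂ) ^ (-((t : ℂ) * I)))
    rw [← hP₁, ← hP₂, ← hP₃] at hsplit
    have hVt := hlarge t ht
    rw [hsumIcc t] at hVt
    rw [Finset.mem_union, Finset.mem_union, hW₁, hW₂, hW₃, Finset.mem_filter, Finset.mem_filter,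
      Finset.mem_filter]
    by_contra hcon
    push Not at hcon
    obtain ⟨⟨h1', h2'⟩, h3'⟩ := hcon
    have := h1' ht; have := h2' ht; have := h3' ht
    linarith
  have htot : (W.card : ℝ) ≤ W₁.card + W₂.card + W₃.card := by
    have := (Finset.card_le_card hcover).trans
      ((Finset.card_union_le _ _).trans (Nat.add_le_add_right (Finset.card_union_le _ _) _))
    exact_mod_cast this
  calc (W.card : ℝ) ≤ W₁.card + W₂.card + W₃.card := htot
    _ ≤ K₁ * q * (T ^ ε) ^ (4 * k) * X + K₁ * q * (T ^ ε) ^ (4 * k) * X +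
          K₁ * q * (T ^ ε) ^ (4 * k) * X := add_le_add (add_le_add h1 h2) h3
    _ = 3 * (K₁ * q) * (T ^ ε) ^ (4 * k) * X := by ring

end mainrange

/-! ## §KERNEL-A, part 5: counting tools for the two trivial ranges -/

section tools

/-- A finite set of reals with pairwise distances `≤ T` and pairwise `1`-separated has at most
`T + 1` elements. [folklore] -/
private theorem card_le_of_pairwise (W : Finset ℝ) {T : ℝ} (hT : 0 ≤ T)
    (hwin : ∀ t ∈ W, ∀ t' ∈ W, |t - t'| ≤ T)
    (hsep : ∀ t ∈ W, ∀ t' ∈ W, t ≠ t' → 1 ≤ |t - t'|) : (W.card : ℝ) ≤ T + 1 := by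
  classical
  rcases W.eq_empty_or_nonempty with hW | hW
  · rw [hW]; simp; linarith
  set tmin : ℝ := W.min' hW with htmin
  have hmin : ∀ t ∈ W, tmin ≤ t := fun t ht ↦ Finset.min'_le W t ht
  have hmem : tmin ∈ W := Finset.min'_mem W hW
  set φ : ℝ → ℝ := fun t ↦ t - tmin with hφ
  have hinj : Function.Injective φ := fun x y h ↦ by simpa [hφ] using h
  have hcard : (W.image φ).card = W.card := Finset.card_image_of_injective _ hinj
  have hpos : ∀ t ∈ W.image φ, 0 ≤ t ∧ t ≤ T := by
    intro t ht
    rw [Finset.mem_image] at ht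
    obtain ⟨s, hs, rfl⟩ := ht
    refine ⟨by simp only [hφ]; linarith [hmin s hs], ?_⟩
    simp only [hφ]
    linarith [le_abs_self (s - tmin), hwin s hs tmin hmem]
  have hsep' : ∀ t ∈ W.image φ, ∀ t' ∈ W.image φ, t ≠ t' → 1 ≤ |t - t'| := by
    intro t ht t' ht' hne
    rw [Finset.mem_image] at ht ht'
    obtain ⟨s, hs, rfl⟩ := ht
    obtain ⟨s', hs', rfl⟩ := ht'
    have hne' : s ≠ s' := fun h ↦ hne (by rw [h])
    simpa [hφ] using hsep s hs s' hs' hne'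
  have h := GuthMaynardReduction.card_le_of_one_sep hT (W.image φ) hpos hsep'
  rwa [hcard] at h

/-- **Windows**: if every subset of `W` with pairwise distances `≤ L` has at most `B` elements and
`W` has pairwise distances `≤ T`, then `#W ≤ (T/L + 1) B` (translate into `[0, T]` and use
`GuthMaynardReduction.card_le_of_subdivision`). [folklore] -/
private theorem card_le_of_windows (W : Finset ℝ) {T L B : ℝ} (hT : 0 ≤ T) (hL : 0 < L) (hB0 : 0 ≤ B)
    (hwin : ∀ t ∈ W, ∀ t' ∈ W, |t - t'| ≤ T)
    (hB : ∀ S ⊆ W, (∀ t ∈ S, ∀ t' ∈ S, |t - t'| ≤ L) → (S.card : ℝ) ≤ B) :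
    (W.card : ℝ) ≤ (T / L + 1) * B := by
  classical
  rcases W.eq_empty_or_nonempty with hW | hW
  · rw [hW]; simp; positivity
  set tmin : ℝ := W.min' hW with htmin
  have hmin : ∀ t ∈ W, tmin ≤ t := fun t ht ↦ Finset.min'_le W t ht
  have hmem : tmin ∈ W := Finset.min'_mem W hW
  set φ : ℝ → ℝ := fun t ↦ t - tmin with hφ
  have hinj : Function.Injective φ := fun x y h ↦ by simpa [hφ] using h
  have hcard : (W.image φ).card = W.card := Finset.card_image_of_injective _ hinj
  have hpos : ∀ t ∈ W.image φ, 0 ≤ t ∧ t ≤ T := by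
    intro t ht
    rw [Finset.mem_image] at ht
    obtain ⟨s, hs, rfl⟩ := ht
    refine ⟨by simp only [hφ]; linarith [hmin s hs], ?_⟩
    simp only [hφ]
    linarith [le_abs_self (s - tmin), hwin s hs tmin hmem]
  have hwin' : ∀ (t₀ : ℝ), ∀ W' ⊆ W.image φ, (∀ t ∈ W', t₀ ≤ t ∧ t ≤ t₀ + L) →
      (W'.card : ℝ) ≤ B := by
    intro t₀ W' hW' hI
    set S : Finset ℝ := W.filter (fun t ↦ φ t ∈ W') with hS
    have hsub : W' ⊆ S.image φ := by
      intro x hx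
      have hx' := hW' hx
      rw [Finset.mem_image] at hx'
      obtain ⟨s, hs, rfl⟩ := hx'
      exact Finset.mem_image.2 ⟨s, by rw [hS, Finset.mem_filter]; exact ⟨hs, hx⟩, rfl⟩
    have h1 : (W'.card : ℝ) ≤ S.card := by
      exact_mod_cast (Finset.card_le_card hsub).trans Finset.card_image_le
    have hSW : S ⊆ W := Finset.filter_subset _ _
    have hSL : ∀ t ∈ S, ∀ t' ∈ S, |t - t'| ≤ L := by
      intro t ht t' ht'
      rw [hS, Finset.mem_filter] at ht ht'
      have h1 := hI _ ht.2
      have h2 := hI _ ht'.2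
      simp only [hφ] at h1 h2
      rw [abs_le]; constructor <;> linarith
    exact h1.trans (hB S hSW hSL)
  have h := GuthMaynardReduction.card_le_of_subdivision hT hL hB0 (W.image φ) hpos hwin'
  rwa [hcard] at h

/-- `|∑_{N<n≤2N} a_n n^{−it}|² ≤ G·N` (Cauchy–Schwarz; `|n^{−it}| = 1`).
[cite: Jutila1977, §1, p. 55] -/
theorem normSq_le_G_mul (a : ℕ → ℂ) (N : ℕ) (t : ℝ) :
    ‖∑ n ∈ Finset.Ioc N (2 * N), a n * (n : ℂ) ^ (-((t : ℂ) * I))‖ ^ 2 ≤ jutilaG a N * N := by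
  have hterm : ∀ n ∈ Finset.Ioc N (2 * N), ‖a n * (n : ℂ) ^ (-((t : ℂ) * I))‖ ≤ ‖a n‖ := by
    intro n hn
    have hn0 : 0 < n := lt_of_le_of_lt (Nat.zero_le N) (Finset.mem_Ioc.mp hn).1
    rw [norm_mul, Complex.norm_natCast_cpow_of_pos hn0]
    simp
  have h1 : ‖∑ n ∈ Finset.Ioc N (2 * N), a n * (n : ℂ) ^ (-((t : ℂ) * I))‖ ≤
      ∑ n ∈ Finset.Ioc N (2 * N), ‖a n‖ := (norm_sum_le _ _).trans (Finset.sum_le_sum hterm)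
  have hCS : (∑ n ∈ Finset.Ioc N (2 * N), ‖a n‖) ^ 2 ≤
      ((Finset.Ioc N (2 * N)).card : ℝ) * ∑ n ∈ Finset.Ioc N (2 * N), ‖a n‖ ^ 2 :=
    sq_sum_le_card_mul_sum_sq
  have hcard : ((Finset.Ioc N (2 * N)).card : ℝ) = N := by
    rw [Nat.card_Ioc, show 2 * N - N = N by omega]
  calc ‖∑ n ∈ Finset.Ioc N (2 * N), a n * (n : ℂ) ^ (-((t : ℂ) * I))‖ ^ 2
      ≤ (∑ n ∈ Finset.Ioc N (2 * N), ‖a n‖) ^ 2 := pow_le_pow_left₀ (norm_nonneg _) h1 2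
    _ ≤ _ := hCS
    _ = jutilaG a N * N := by rw [hcard, jutilaG]; ring

/-- `(T^ε)^{4k} ≤ T^{ε₀}` for `ε = ε₀/(4k+1)`, `T ≥ 1`, `ε₀ ≥ 0`. [folklore] -/
private theorem rpow_pow_le {T ε₀ : ℝ} (hT : 1 ≤ T) (hε₀ : 0 ≤ ε₀) (k : ℕ) :
    (T ^ (ε₀ / (4 * k + 1))) ^ (4 * k) ≤ T ^ ε₀ := by
  rw [← Real.rpow_natCast, ← Real.rpow_mul (by linarith)]
  apply Real.rpow_le_rpow_of_exponent_le hT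
  have hk : (0 : ℝ) ≤ (4 * k : ℕ) := by positivity
  have hden : (0 : ℝ) < 4 * k + 1 := by positivity
  rw [div_mul_eq_mul_div, div_le_iff₀ hden]
  push_cast
  nlinarith

end tools

/-! ## §KERNEL-A, part 6: the apex `CORE₀` from the pair-correlation bound -/

section apex

/-- Trivial range `N < M₀`: `R ≤ T + 1 ≤ 2 M₀^{2k} (TG²V^{−4})^k` when `V² ≤ GN`, `N ≤ M₀`, `T ≥ 1`.
[folklore] -/
private lemma triv_range {R T G Nr V M₀ : ℝ} {k : ℕ} (hk : 1 ≤ k) (hT : 1 ≤ T) (hV : 0 < V)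
    (hNr : 0 < Nr) (hNM : Nr ≤ M₀) (hG : 0 ≤ G) (hGN : V ^ 2 ≤ G * Nr) (hR : R ≤ T + 1) :
    R ≤ 2 * M₀ ^ (2 * k) * (T * G ^ 2 * V ^ (-4 : ℝ)) ^ k := by
  have hM0 : 0 < M₀ := lt_of_lt_of_le hNr hNM
  have hV2 : 0 < V ^ 2 := by positivity
  have hV4 : V ^ (-4 : ℝ) = (V ^ 2)⁻¹ ^ 2 := by
    rw [Real.rpow_neg hV.le, show (4 : ℝ) = (4 : ℕ) by norm_num, Real.rpow_natCast]; ring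
  -- `G / V² ≥ 1 / Nr`
  set y : ℝ := G * (V ^ 2)⁻¹ with hy
  have hy1 : 1 ≤ y * Nr := by
    rw [hy]
    have : G * (V ^ 2)⁻¹ * Nr = (G * Nr) / V ^ 2 := by ring
    rw [this, le_div_iff₀ hV2]; linarith
  have hy0 : 0 ≤ y := by positivity
  -- `T G² V⁻⁴ = T y² ≥ T / M₀²`
  have h1 : T ≤ M₀ ^ 2 * (T * G ^ 2 * V ^ (-4 : ℝ)) := by
    rw [hV4]
    have e : M₀ ^ 2 * (T * G ^ 2 * ((V ^ 2)⁻¹) ^ 2) = T * (y * M₀) ^ 2 := by rw [hy]; ring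
    rw [e]
    have hyM : 1 ≤ y * M₀ := hy1.trans (mul_le_mul_of_nonneg_left hNM hy0)
    have : 1 ≤ (y * M₀) ^ 2 := one_le_pow₀ hyM
    nlinarith
  have hc0 : 0 ≤ T * G ^ 2 * V ^ (-4 : ℝ) := by positivity
  have h2 : T ≤ M₀ ^ (2 * k) * (T * G ^ 2 * V ^ (-4 : ℝ)) ^ k := by
    -- `T ≤ T^k ≤ (M₀² c)^k = M₀^{2k} c^k`
    have hTk : T ≤ T ^ k := by
      calc T = T ^ 1 := (pow_one T).symm
        _ ≤ T ^ k := pow_le_pow_right₀ hT hk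
    calc T ≤ T ^ k := hTk
      _ ≤ (M₀ ^ 2 * (T * G ^ 2 * V ^ (-4 : ℝ))) ^ k := pow_le_pow_left₀ (by linarith) h1 k
      _ = M₀ ^ (2 * k) * (T * G ^ 2 * V ^ (-4 : ℝ)) ^ k := by rw [mul_pow, pow_mul]
  linarith

/-- Subdivision range `T > L = (N/2)^{2k+1}`: `(T/L)·X(L) ≤ (2^{2k+1} + 1)·X(T)` using
`GNV^{−2} ≥ 1`, `N ≥ 1`, `L ≤ T`. [folklore] -/
private lemma subdiv_range {T L G Nr V : ℝ} {k : ℕ} (hk : 1 ≤ k) (hLT : L ≤ T) (hL : 0 < L)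
    (hNr : 1 ≤ Nr) (hV : 0 < V) (hx : 1 ≤ G * Nr * V ^ (-2 : ℝ))
    (hLdef : L = (Nr / 2) ^ (2 * k + 1)) :
    T / L * (G * Nr * V ^ (-2 : ℝ) + L * (G ^ 4 * Nr ^ 2 * V ^ (-8 : ℝ)) ^ k +
        (L * G ^ 2 * V ^ (-4 : ℝ)) ^ k) ≤
      ((2 : ℝ) ^ (2 * k + 1) + 1) * (G * Nr * V ^ (-2 : ℝ) + T * (G ^ 4 * Nr ^ 2 * V ^ (-8 : ℝ)) ^ k +
        (T * G ^ 2 * V ^ (-4 : ℝ)) ^ k) := by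
  have hNr0 : 0 < Nr := by linarith
  have hT0 : 0 < T := lt_of_lt_of_le hL hLT
  set x : ℝ := G * Nr * V ^ (-2 : ℝ) with hxdef
  set b : ℝ := (G ^ 4 * Nr ^ 2 * V ^ (-8 : ℝ)) ^ k with hb
  set c : ℝ := G ^ 2 * V ^ (-4 : ℝ) with hc
  have hx0 : 0 ≤ x := by positivity
  have hb0 : 0 ≤ b := by positivity
  have hc0 : 0 ≤ c := by positivity
  -- term 2
  have t2 : T / L * (L * b) = T * b := by field_simp
  -- term 3
  have key : ∀ c' : ℝ, 0 ≤ c' → T / L * (L * c') ^ k ≤ (T * c') ^ k := by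
    intro c' hc'
    obtain ⟨j, rfl⟩ : ∃ j, k = j + 1 := ⟨k - 1, by omega⟩
    have hLj : L ^ j ≤ T ^ j := pow_le_pow_left₀ hL.le hLT j
    calc T / L * (L * c') ^ (j + 1) = T * L ^ j * c' ^ (j + 1) := by
          rw [mul_pow, pow_succ]; field_simp
      _ ≤ T * T ^ j * c' ^ (j + 1) := by gcongr
      _ = (T * c') ^ (j + 1) := by rw [mul_pow, pow_succ]; ring
  have t3 : T / L * (L * G ^ 2 * V ^ (-4 : ℝ)) ^ k ≤ (T * G ^ 2 * V ^ (-4 : ℝ)) ^ k := by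
    rw [show L * G ^ 2 * V ^ (-4 : ℝ) = L * c by rw [hc]; ring,
      show T * G ^ 2 * V ^ (-4 : ℝ) = T * c by rw [hc]; ring]
    exact key c hc0
  -- term 1: `T x / L ≤ 2^{2k+1} T b`
  have hV28 : (V ^ (-2 : ℝ)) ^ 4 = V ^ (-8 : ℝ) := by
    rw [← Real.rpow_natCast, ← Real.rpow_mul hV.le]; norm_num
  have hx4 : x ^ 4 = Nr ^ 2 * (G ^ 4 * Nr ^ 2 * V ^ (-8 : ℝ)) := by rw [hxdef, ← hV28]; ring
  have hx4k : x ^ (4 * k) = Nr ^ (2 * k) * b := by rw [pow_mul, hx4, mul_pow, ← pow_mul, hb]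
  have t1 : T / L * x ≤ (2 : ℝ) ^ (2 * k + 1) * (T * b) := by
    rw [hLdef, div_pow]
    have hNpow : 0 < Nr ^ (2 * k + 1) := by positivity
    have e : T / (Nr ^ (2 * k + 1) / 2 ^ (2 * k + 1)) * x =
        (2 : ℝ) ^ (2 * k + 1) * T * (x / Nr ^ (2 * k + 1)) := by
      field_simp
    rw [e]
    have hx1 : x ≤ x ^ (4 * k) := by
      calc x = x ^ 1 := (pow_one x).symm
        _ ≤ x ^ (4 * k) := pow_le_pow_right₀ hx (by omega)
    have hkey : x / Nr ^ (2 * k + 1) ≤ b := by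
      rw [div_le_iff₀ hNpow]
      calc x ≤ x ^ (4 * k) := hx1
        _ = Nr ^ (2 * k) * b := hx4k
        _ ≤ Nr ^ (2 * k + 1) * b := by
            apply mul_le_mul_of_nonneg_right _ hb0
            exact pow_le_pow_right₀ hNr (by omega)
        _ = b * Nr ^ (2 * k + 1) := by ring
    have h2pos : 0 ≤ (2 : ℝ) ^ (2 * k + 1) * T := by positivity
    calc (2 : ℝ) ^ (2 * k + 1) * T * (x / Nr ^ (2 * k + 1))
        ≤ (2 : ℝ) ^ (2 * k + 1) * T * b := mul_le_mul_of_nonneg_left hkey h2pos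
      _ = _ := by ring
  have hsum : T / L * (x + L * b + (L * G ^ 2 * V ^ (-4 : ℝ)) ^ k) =
      T / L * x + T / L * (L * b) + T / L * (L * G ^ 2 * V ^ (-4 : ℝ)) ^ k := by ring
  rw [hsum, t2]
  have hTb : 0 ≤ T * b := by positivity
  have hTc : 0 ≤ (T * G ^ 2 * V ^ (-4 : ℝ)) ^ k := by positivity
  have h2k : (1 : ℝ) ≤ (2 : ℝ) ^ (2 * k + 1) := one_le_pow₀ (by norm_num)
  nlinarith [t1, t3, hTb, hTc, hx0, h2k]

set_option maxHeartbeats 1600000 in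
/-- **Jutila's Theorem (1.2) at `q = 1`, `σ = 0` (the cell's `CORE₀`), from the pair-correlation
bound.** For every `k ≥ 1` and `ε > 0` there is `C` such that for `N ≥ 1`, `T ≥ 2`, `V > 0`,
coefficients `a_n` (`G = ∑_{N<n≤2N}|a_n|²`) and a finite set `W` of real `t` with pairwise distances
`≤ T`, pairwise `1`-separated, and `|∑_{N<n≤2N} a_n n^{−it}| ≥ V` on `W`:
`#W ≤ C T^ε (GNV^{−2} + T(G⁴N²V^{−8})^k + (TG²V^{−4})^k)` — Jutila's (1.2) with `q = 1`
("`R ≪ (GNV^{−2} + T(G⁴N²V^{−8})^k + (TG²V^{−4})^k)T^ε`", p. 56) for points on the line `σ = 0`.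
The hypothesis `hB` is the pair-correlation bound for `B_N` (Guth–Maynard Lemma 6.2 + Heath-Brown,
the cell's KERNEL-B statement); the rest is §3 of the paper: Halász–Montgomery in sum form for the
three smoothly weighted pieces, the Gram entries by Poisson summation, the `A`-part by the decay
`|A(τ)| ≪ |τ|^{−2}`, and the final solving for `R`; the ranges `N < N₁` and `T > (N/2)^{2k+1}` are
trivial (`R ≤ T + 1`, resp. Huxley subdivision into windows of length `(N/2)^{2k+1}`).
[cite: Jutila1977, Theorem (1.2) (q = 1), p. 56; §3, pp. 59–60]
[cite: GuthMaynard2026, Lemmas 4.3, 4.5, 6.2] -/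
theorem _root_.Literature.NumberTheory.LFunctions.Jutila1977.core_of_pairBound
    (hB : ∀ {w : ℝ → ℝ}, ContDiff ℝ ∞ w → Function.support w ⊆ Set.Icc 1 2 →
      ∀ {k : ℕ}, 1 ≤ k → ∀ {A : ℝ}, 1 ≤ A → ∀ {ε : ℝ}, 0 < ε → ∃ C N₀ : ℝ, 0 ≤ C ∧
      ∀ N : ℕ, N₀ ≤ (N : ℝ) → ∀ T : ℝ, 1 ≤ T → T ≤ (N : ℝ) ^ A → ∀ W : Finset ℝ,
      (∀ t ∈ W, ∀ t' ∈ W, |t - t'| ≤ T) → (∀ t ∈ W, ∀ t' ∈ W, t ≠ t' → 1 ≤ |t - t'|) →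
      (N : ℝ) * ∑ t ∈ W, ∑ t' ∈ W,
          (if t ≠ t' then ‖GuthMaynardFourier.coefB w N (t - t')‖ else 0) ≤
        C * T ^ ε * ((W.card : ℝ) + (N : ℝ) ^ (1 / 2 : ℝ) * (W.card : ℝ) ^ (2 - 1 / (k : ℝ)) *
          ((W.card : ℝ) * ((T / N) ^ k + ((W.card : ℝ) * T) ^ (1 / 2 : ℝ))) ^ (1 / (2 * (k : ℝ))))) :
    ∀ k : ℕ, 1 ≤ k → ∀ ε : ℝ, 0 < ε → ∃ C : ℝ,
      ∀ (N : ℕ) (T V : ℝ) (a : ℕ → ℂ) (W : Finset ℝ),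
      1 ≤ N → 2 ≤ T → 0 < V →
      (∀ t ∈ W, ∀ t' ∈ W, |t - t'| ≤ T) →
      (∀ t ∈ W, ∀ t' ∈ W, t ≠ t' → 1 ≤ |t - t'|) →
      (∀ t ∈ W, V ≤ ‖∑ n ∈ Finset.Ioc N (2 * N), a n * (n : ℂ) ^ (-((t : ℂ) * I))‖) →
      (W.card : ℝ) ≤ C * T ^ ε * (jutilaG a N * N * V ^ (-2 : ℝ) +
        T * (jutilaG a N ^ 4 * (N : ℝ) ^ 2 * V ^ (-8 : ℝ)) ^ k +
        (T * jutilaG a N ^ 2 * V ^ (-4 : ℝ)) ^ k) := by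
  intro k hk ε₀ hε₀
  classical
  -- the weight and its constants
  obtain ⟨w, hw, hsupp, hw1, -⟩ := GuthMaynardAssembly.exists_weight
  obtain ⟨cA, -, hcA⟩ := GuthMaynardFourier.norm_coefA_le hw hsupp
  obtain ⟨cBc, hcBc0, hcBc⟩ := GuthMaynardFourier.norm_coefB_le hw hsupp (le_refl 2)
  have hcB : ∀ N' : ℕ, 1 ≤ N' → ‖GuthMaynardFourier.coefB w N' 0‖ ≤ cBc := by
    intro N' hN'
    have hN'1 : (1 : ℝ) ≤ N' := by exact_mod_cast hN'
    have h := hcBc 0 N' hN'1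
    have hN'2 : (1 : ℝ) ≤ (N' : ℝ) ^ 2 := one_le_pow₀ hN'1
    calc ‖GuthMaynardFourier.coefB w N' 0‖ ≤ cBc * (1 + |(0 : ℝ)|) ^ 2 / (N' : ℝ) ^ 2 := h
      _ = cBc / (N' : ℝ) ^ 2 := by simp
      _ ≤ cBc := div_le_self hcBc0 hN'2
  obtain ⟨c₂, -, hc₂⟩ := GuthMaynardFourier.norm_coefA_le_div hw hsupp 2
  -- parameters
  set ε : ℝ := ε₀ / (4 * k + 1) with hεdef
  have hε : 0 < ε := by positivity
  set A : ℝ := ((2 * k + 1 : ℕ) : ℝ) with hAdef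
  have hA1 : 1 ≤ A := by rw [hAdef]; exact_mod_cast (by omega : 1 ≤ 2 * k + 1)
  obtain ⟨CB, N₀, hCB0, hBN⟩ := hB hw hsupp hk hA1 hε
  -- constants
  set K : ℝ := 3 * ((3 * max 1 (cA + cBc + 16 * c₂ + CB)) ^ (4 * k) * (4 * 3 ^ 8 : ℝ) ^ k) with hK
  have hK0 : 0 ≤ K := by positivity
  set M₀ : ℝ := max (2 * N₀) 8 with hM₀
  have hM₀8 : (8 : ℝ) ≤ M₀ := le_max_right _ _
  have hM₀0 : 0 < M₀ := by linarith
  set Cfin : ℝ := max (2 * M₀ ^ (2 * k)) (2 * ((2 : ℝ) ^ (2 * k + 1) + 1) * K) with hCfin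
  have hCfin0 : 0 ≤ Cfin := le_trans (by positivity) (le_max_left _ _)
  refine ⟨Cfin, fun N T V a W hN hT hV hwin hsep hlarge ↦ ?_⟩
  have hN1 : (1 : ℝ) ≤ N := by exact_mod_cast hN
  have hN0 : (0 : ℝ) < N := by linarith
  have hT1 : 1 ≤ T := by linarith
  have hT0 : 0 < T := by linarith
  set G : ℝ := jutilaG a N with hGdef
  have hG0 : 0 ≤ G := jutilaG_nonneg a N
  set X : ℝ := G * N * V ^ (-2 : ℝ) + T * (G ^ 4 * (N : ℝ) ^ 2 * V ^ (-8 : ℝ)) ^ k +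
    (T * G ^ 2 * V ^ (-4 : ℝ)) ^ k with hX
  have hX0 : 0 ≤ X := by positivity
  have hX3 : (T * G ^ 2 * V ^ (-4 : ℝ)) ^ k ≤ X := by
    have : 0 ≤ G * N * V ^ (-2 : ℝ) + T * (G ^ 4 * (N : ℝ) ^ 2 * V ^ (-8 : ℝ)) ^ k := by positivity
    linarith
  have hTε₀ : 1 ≤ T ^ ε₀ := Real.one_le_rpow hT1 hε₀.le
  have hgoal0 : 0 ≤ Cfin * T ^ ε₀ * X := by positivity
  -- `Cfin X ≤ Cfin T^ε₀ X`
  have hup : ∀ {y : ℝ}, 0 ≤ y → y ≤ Cfin → ∀ {Z : ℝ}, 0 ≤ Z → Z ≤ X → (W.card : ℝ) ≤ y * Z →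
      (W.card : ℝ) ≤ Cfin * T ^ ε₀ * X := by
    intro y hy hyC Z hZ hZX h
    calc (W.card : ℝ) ≤ y * Z := h
      _ ≤ Cfin * X := mul_le_mul hyC hZX hZ hCfin0
      _ = Cfin * 1 * X := by ring
      _ ≤ Cfin * T ^ ε₀ * X := by gcongr
  rcases W.eq_empty_or_nonempty with hW | hW
  · rw [hW, Finset.card_empty, Nat.cast_zero]; exact hgoal0
  -- `V² ≤ G N`
  obtain ⟨t₀, ht₀⟩ := hW
  have hGN : V ^ 2 ≤ G * N := by
    calc V ^ 2 ≤ ‖∑ n ∈ Finset.Ioc N (2 * N), a n * (n : ℂ) ^ (-((t₀ : ℂ) * I))‖ ^ 2 :=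
          pow_le_pow_left₀ hV.le (hlarge t₀ ht₀) 2
      _ ≤ G * N := normSq_le_G_mul a N t₀
  have hx1 : 1 ≤ G * N * V ^ (-2 : ℝ) := by
    have hV2 : 0 < V ^ 2 := by positivity
    rw [Real.rpow_neg hV.le, show (2 : ℝ) = (2 : ℕ) by norm_num, Real.rpow_natCast,
      ← div_eq_mul_inv, le_div_iff₀ hV2]; linarith
  have hcardT : (W.card : ℝ) ≤ T + 1 := card_le_of_pairwise W hT0.le hwin hsep
  by_cases hsmall : (N : ℝ) < M₀
  · -- trivial range
    have h := triv_range (R := (W.card : ℝ)) hk hT1 hV hN0 hsmall.le hG0 hGN hcardT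
    exact hup (by positivity) (le_max_left _ _) (by positivity) hX3 h
  push Not at hsmall
  have hN8 : 8 ≤ N := by
    have : (8 : ℝ) ≤ N := hM₀8.trans hsmall
    exact_mod_cast this
  have hNN₀ : N₀ ≤ (N : ℝ) / 2 := by
    have : 2 * N₀ ≤ M₀ := le_max_left _ _
    linarith
  have hmainK : K ≤ 2 * ((2 : ℝ) ^ (2 * k + 1) + 1) * K := by
    have : (1 : ℝ) ≤ 2 * ((2 : ℝ) ^ (2 * k + 1) + 1) := by
      have := one_le_pow₀ (M₀ := ℝ) (a := 2) (n := 2 * k + 1) (by norm_num)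
      linarith
    nlinarith
  have hKC : 2 * ((2 : ℝ) ^ (2 * k + 1) + 1) * K ≤ Cfin := le_max_right _ _
  set L : ℝ := ((N : ℝ) / 2) ^ A with hLdef
  have hLnat : L = ((N : ℝ) / 2) ^ (2 * k + 1) := by
    rw [hLdef, hAdef, Real.rpow_natCast]
  have hL1 : 1 ≤ L := by
    rw [hLnat]
    exact one_le_pow₀ (by linarith : (1 : ℝ) ≤ (N : ℝ) / 2)
  have hL0 : 0 < L := by linarith
  by_cases hTA : T ≤ L
  · -- main range
    have h := core_main hw hsupp hw1 hk hε.le (by linarith) hCB0 hcA hcB hc₂ hBN N T V a W hN8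
      hNN₀ hT1 hTA hV hwin hsep hlarge
    have hTpow : (T ^ ε) ^ (4 * k) ≤ T ^ ε₀ := by rw [hεdef]; exact rpow_pow_le hT1 hε₀.le k
    calc (W.card : ℝ) ≤ K * (T ^ ε) ^ (4 * k) * X := by rw [hK, hX]; exact h
      _ ≤ Cfin * T ^ ε₀ * X := by
          apply mul_le_mul_of_nonneg_right _ hX0
          exact mul_le_mul (hmainK.trans hKC) hTpow (by positivity) hCfin0
  · -- subdivision range: windows of length `L`
    push Not at hTA
    have hLT : L ≤ T := hTA.le
    set XL : ℝ := G * N * V ^ (-2 : ℝ) + L * (G ^ 4 * (N : ℝ) ^ 2 * V ^ (-8 : ℝ)) ^ k +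
      (L * G ^ 2 * V ^ (-4 : ℝ)) ^ k with hXL
    have hXL0 : 0 ≤ XL := by positivity
    set B : ℝ := K * (L ^ ε) ^ (4 * k) * XL with hBdef
    have hB0 : 0 ≤ B := by positivity
    have hwindows : ∀ S ⊆ W, (∀ t ∈ S, ∀ t' ∈ S, |t - t'| ≤ L) → (S.card : ℝ) ≤ B := by
      intro S hSW hSL
      have h := core_main hw hsupp hw1 hk hε.le (by linarith) hCB0 hcA hcB hc₂ hBN N L V a S hN8
        hNN₀ hL1 le_rfl hV hSL (fun t ht t' ht' hne ↦ hsep t (hSW ht) t' (hSW ht') hne)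
        (fun t ht ↦ hlarge t (hSW ht))
      rw [hBdef, hK, hXL]; exact h
    have hsub := card_le_of_windows W hT0.le hL0 hB0 hwin hwindows
    have hTL1 : 1 ≤ T / L := by rw [le_div_iff₀ hL0]; linarith
    have hLε : (L ^ ε) ^ (4 * k) ≤ (T ^ ε) ^ (4 * k) :=
      pow_le_pow_left₀ (by positivity) (Real.rpow_le_rpow hL0.le hLT hε.le) _
    have hTpow : (T ^ ε) ^ (4 * k) ≤ T ^ ε₀ := by rw [hεdef]; exact rpow_pow_le hT1 hε₀.le k
    have halg := subdiv_range (T := T) hk hLT hL0 hN1 hV hx1 hLnat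
    calc (W.card : ℝ) ≤ (T / L + 1) * B := hsub
      _ ≤ (2 * (T / L)) * B := mul_le_mul_of_nonneg_right (by linarith) hB0
      _ = 2 * K * (L ^ ε) ^ (4 * k) * (T / L * XL) := by rw [hBdef]; ring
      _ ≤ 2 * K * (T ^ ε) ^ (4 * k) * (((2 : ℝ) ^ (2 * k + 1) + 1) * X) := by
          apply mul_le_mul _ (by rw [hXL, hX]; exact halg) (by positivity) (by positivity)
          exact mul_le_mul_of_nonneg_left hLε (by positivity)
      _ = (2 * ((2 : ℝ) ^ (2 * k + 1) + 1) * K) * (T ^ ε) ^ (4 * k) * X := by ring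
      _ ≤ Cfin * T ^ ε₀ * X := by
          apply mul_le_mul_of_nonneg_right _ hX0
          exact mul_le_mul hKC hTpow (by positivity) hCfin0

end apex

end KernelA

/-! ## §HOLDS (conditional form, pending §KERNEL-B): the landed outer chain applied to KERNEL-A

With O1 (`Jutila1977.eq_1_2_q1_of_core`, seat rh-crit-gm-t6) and O2
(`Jutila1977.theorem_1_4_of_theorem_1_2`, seat rh-crit-gm-t9) in the tree, the pair-correlation bound
alone now implies Jutila's Theorem (1.4) as printed and the interface `Jutila1977_largeValues`. -/

/-- **Jutila's Theorem (1.4) AS PRINTED from the pair-correlation bound** (KERNEL-A ∘ O1 ∘ O2).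
[cite: Jutila1977, Theorem (1.4), p. 56; §3, pp. 59–60] -/
theorem theorem_1_4_of_pairBound
    (hB : ∀ {w : ℝ → ℝ}, ContDiff ℝ ∞ w → Function.support w ⊆ Set.Icc 1 2 →
      ∀ {k : ℕ}, 1 ≤ k → ∀ {A : ℝ}, 1 ≤ A → ∀ {ε : ℝ}, 0 < ε → ∃ C N₀ : ℝ, 0 ≤ C ∧
      ∀ N : ℕ, N₀ ≤ (N : ℝ) → ∀ T : ℝ, 1 ≤ T → T ≤ (N : ℝ) ^ A → ∀ W : Finset ℝ,
      (∀ t ∈ W, ∀ t' ∈ W, |t - t'| ≤ T) → (∀ t ∈ W, ∀ t' ∈ W, t ≠ t' → 1 ≤ |t - t'|) →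
      (N : ℝ) * ∑ t ∈ W, ∑ t' ∈ W,
          (if t ≠ t' then ‖GuthMaynardFourier.coefB w N (t - t')‖ else 0) ≤
        C * T ^ ε * ((W.card : ℝ) + (N : ℝ) ^ (1 / 2 : ℝ) * (W.card : ℝ) ^ (2 - 1 / (k : ℝ)) *
          ((W.card : ℝ) * ((T / N) ^ k + ((W.card : ℝ) * T) ^ (1 / 2 : ℝ))) ^ (1 / (2 * (k : ℝ))))) :
    Jutila1977_theorem_1_4 :=
  theorem_1_4_of_theorem_1_2 (eq_1_2_q1_of_core (core_of_pairBound hB))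

/-- **`Jutila1977_largeValues` (Teräväinen's form, the leaf used by Guth–Maynard Prop. 12.1) from
the pair-correlation bound** (∘ `Jutila1977_largeValues_of_theorem_1_4`).
[cite: Jutila1977, Theorem (1.4), p. 56] [cite: Teravainen2016, Lemma 7] -/
theorem largeValues_of_pairBound
    (hB : ∀ {w : ℝ → ℝ}, ContDiff ℝ ∞ w → Function.support w ⊆ Set.Icc 1 2 →
      ∀ {k : ℕ}, 1 ≤ k → ∀ {A : ℝ}, 1 ≤ A → ∀ {ε : ℝ}, 0 < ε → ∃ C N₀ : ℝ, 0 ≤ C ∧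
      ∀ N : ℕ, N₀ ≤ (N : ℝ) → ∀ T : ℝ, 1 ≤ T → T ≤ (N : ℝ) ^ A → ∀ W : Finset ℝ,
      (∀ t ∈ W, ∀ t' ∈ W, |t - t'| ≤ T) → (∀ t ∈ W, ∀ t' ∈ W, t ≠ t' → 1 ≤ |t - t'|) →
      (N : ℝ) * ∑ t ∈ W, ∑ t' ∈ W,
          (if t ≠ t' then ‖GuthMaynardFourier.coefB w N (t - t')‖ else 0) ≤
        C * T ^ ε * ((W.card : ℝ) + (N : ℝ) ^ (1 / 2 : ℝ) * (W.card : ℝ) ^ (2 - 1 / (k : ℝ)) *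
          ((W.card : ℝ) * ((T / N) ^ k + ((W.card : ℝ) * T) ^ (1 / 2 : ℝ))) ^ (1 / (2 * (k : ℝ))))) :
    Jutila1977_largeValues :=
  Jutila1977_largeValues_of_theorem_1_4 (theorem_1_4_of_pairBound hB)

end Jutila1977

end Literature.NumberTheory.LFunctions
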